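import Literature.NumberTheory.Sieve.LargeSieveInequality
import HarnessLib

/-!
# A multidimensional large sieve at the rational points `b/q` (Heath-Brown 2001, Lemma 13.1)

D. R. Heath-Brown, *Primes represented by `x³ + 2y³`*, Acta Math. 186 (2001), §13, proves his Type II
estimate (Lemma 3.10) with the following three-dimensional large sieve (Lemma 13.1, p. 79; G. Harman,
*Prime-Detecting Sieves*, Lemma 13.23): for `S(a) = ∑_{β ∈ C} G_β e(a·β)` with `C ⊂ ℤ³` a cube of
side `S₀`,

  `∑_{Q < q ≤ 2Q} ∑*_{b (mod q)} |S(q⁻¹b)|² ≪ (S₀³ + Q²S₀² + Q⁴) ∑_{β ∈ C} |G_β|²`,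

`∑*` denoting summation over `h.c.f.(q, b₁, b₂, b₃) = 1` ("Various multi-dimensional forms of the large
sieve appear in the literature, but none seem quite suited to our purpose. In particular, the estimate
of Huxley [13] would have the factor `S₀³ + Q⁶` when applied to our situation, and this is too large.")
This file PROVES the inequality in every dimension `k` with explicit constants
(`largeSieve_multidim`):

  `∑_{(q,b)} |∑_β G_β e(β·b/q)|² ≤ ((2N)^k + k·80Q²·(6(N + 2Q))^{k−1}) ∑_β |G_β|²`

for weights on a lattice box `∏_l (lo_l, lo_l + N]`, and the case `k = 3` in Heath-Brown's shape with the
constant `51840` (`largeSieve_dim_three`).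

## The argument

Heath-Brown iterates the Sobolev–Gallagher inequality in three variables, applies Parseval, and counts
the points `(q, b)` with `|b_j/q − t_j| ≤ S₀⁻¹` ((13.3): `≪ 1 + Q²S₀⁻¹ + Q⁴S₀⁻³`).  We obtain the same
bound by Bombieri's duality argument (Huxley 1972, ch. 7), already used for the one-dimensional
inequality of `LargeSieveInequality.lean` (`duality`, trapezoid kernel `trapK` with
`|K(α)| ≤ min(2M+L, (4L)⁻¹(v⁻² + (1−v)⁻²))`, `v = fract α`), with the product kernel
`K(α) = ∏_l K_l(α_l)` (`L = N`, plateau containing the box).  By duality it suffices to bound the row sums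
`∑_{(q,b)} ∏_l |K_l(b_l/q − a_l/r)|` for a fixed point `(r, a)` (`rowSum_le`): the diagonal term is
`(2M+L)^k ≤ (2N)^k`; a point `(q, b) ≠ (r, a)` differs from it in some coordinate `i`, i.e.
`b_i/q ≠ a_i/r` — here primitivity enters (`eq_of_isPrimVec_of_proportional`); summing over all
`b ∈ [0,q)^k` with `b_i/q ≠ a_i/r` the sum factorises, the `k − 1` free coordinates contribute
`≤ 6(N + q)` each (**Lemma A**, `sum_norm_trapK_div_sub_le'`: the points `b_l/q` are `1/q`-spaced
modulo one) and the coordinate `i` together with the sum over `q ∈ (Q, 2Q]` contributes `≤ 80Q²`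
(**Lemma B**, `sum_sum_norm_trapK_le'`): writing `v = fract(b/q − a/r) = s₁/(qr)`, `1 − v = s₂/(qr)`
with positive integers `s_i ≤ 4Q²` divisible by `d = gcd(a, r)`, the fibres of `(q, b) ↦ s_i` have at
most `2(d + 1)` elements (the `q` in a fibre are congruent modulo `r/d`, `card_Ioc_filter_dvd_le` — the
analogue of Heath-Brown's count on p. 80), and `∑_{t ≥ 1} min(2N, 4Q⁴/(N d² t²))·4d ≪ Q²` with the
break-point `t ≈ Q²/(Nd)` (`sum_min_fibre_le`).  Both lemmas rest on a "spacing lemma with a ceiling"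
(`sum_min_inv_sq_le_of_separated`: `∑_{t ∈ T} min(A₀, C/t²) ≤ A₀(J+1) + 2C/(δ²(J+1))` for a `δ`-separated
set `T` of positive reals and every `J`).

## Main statements

* `largeSieve_multidim` — dimension `k`, box of side `N ≥ 1`, points `fareyVecs k Q`
  (`Q < q ≤ 2Q`, `b ∈ [0, q)^k`, `h.c.f.(q, b) = 1`).
* `largeSieve_dim_three` — Heath-Brown's Lemma 13.1: `≤ 51840 (N³ + Q²N² + Q⁴) ∑ |G_β|²`.
* Tools: `norm_trapK_le_sum`, `norm_trapK_le_fract` (kernel bounds), `sum_min_inv_sq_le_of_separated`,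
  `sum_norm_trapK_div_sub_le` (Lemma A), `card_Ioc_filter_dvd_le`, `card_pairsB_fibre_le`,
  `sum_min_fibre_le`, `sum_sum_norm_trapK_le` (Lemma B), `IsPrimVec`, `fareyVecs`, `latticeBox`,
  `eq_of_isPrimVec_of_proportional`, `rowSum_le`.

All declarations live in the namespace `Literature.NumberTheory.Sieve.LargeSieve` of the one-dimensional
file; everything is a finite sum and no measure theory is used.

## References

* D. R. Heath-Brown, *Primes represented by `x³ + 2y³`*, Acta Math. 186 (2001), 1–84: §13, Lemma 13.1,
  (13.1)–(13.3), pp. 78–81. [cite: HeathBrownActa2001, Lemma 13.1]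
* G. Harman, *Prime-Detecting Sieves*, LMS Monographs 33, Princeton (2007), §13.8, Lemma 13.23, p. 282.
  [cite: Harman2007, Lemma 13.23]
* M. N. Huxley, *The Distribution of Prime Numbers*, Oxford (1972), ch. 7, (7.11)–(7.25) (duality and the
  trapezoid kernel). [cite: Huxley1972, Ch. 7]
* M. N. Huxley, *The large sieve inequality for algebraic number fields*, Mathematika 15 (1968), 178–187
  (the bound `(S₀ + Q²)³` Heath-Brown improves on).

## Mathlib / tree search

Mathlib: no large sieve in any dimension (searched `largeSieve`, `LargeSieve`, `Gallagher`); used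
`Finset.prod_univ_sum`, `Finset.sum_sigma`, `Fintype.piFinset`, `Finset.induction_on_max`,
`sum_Ioo_inv_sq_le`, `Int.fract`, `Int.gcd_div_gcd_div_gcd`, `Nat.coprime_div_gcd_div_gcd`,
`IsCoprime.dvd_of_dvd_mul_right`, `Nat.modEq_iff_dvd`, `Nat.add_div` (the tree's
`Literature.NumberTheory.LFunctions.MRT2015.add_div_le` is the same remark; not imported). Tree:
`Literature.NumberTheory.Sieve.LargeSieve` (`LargeSieveInequality.lean`: `e`, `trapW`, `trapK`, `window`,
`duality`, `norm_trapK_le`, `trapK_zero`, `trapW_eq_one`, `inv_sin_sq_le`, `norm_e_sub_one_sq`,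
`largeSieve_wellSpaced`, whose proof pattern is followed).
-/

noncomputable section

open Finset Real Complex
open scoped ComplexConjugate

namespace Literature.NumberTheory.Sieve.LargeSieve

/-! ### More on the trapezoid kernel -/

section Kernel

variable (c : ℤ) (M L : ℕ)

/-- `∑_m w(m) = 2M + L` (the value `K(0)`). [folklore] -/
theorem sum_trapW (hL : 0 < L) : ∑ m ∈ window c M L, trapW c M L m = ((2 * M + L : ℕ) : ℝ) := by
  have h := trapK_zero c M L hL
  unfold trapK at h
  simp only [mul_zero, e_zero, mul_one] at h
  exact_mod_cast h

/-- The trivial bound `|K(α)| ≤ ∑_m w(m) = 2M + L`. [folklore] -/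
theorem norm_trapK_le_sum (hL : 0 < L) (α : ℝ) : ‖trapK c M L α‖ ≤ ((2 * M + L : ℕ) : ℝ) := by
  unfold trapK
  refine (norm_sum_le _ _).trans ?_
  rw [← sum_trapW c M L hL]
  refine le_of_eq (sum_congr rfl fun m _ => ?_)
  rw [norm_mul, norm_e, mul_one, Complex.norm_real, Real.norm_of_nonneg (trapW_nonneg c M L m)]

/-- Kernel decay off the integers: with `v = fract α ≠ 0`,
`|K(α)| ≤ (4L)⁻¹ (v⁻² + (1 − v)⁻²)` (Huxley 1972, (7.24) with Jordan's inequality).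
[cite: Huxley1972, Ch. 7, (7.24)] -/
theorem norm_trapK_le_fract (hL : 0 < L) {α : ℝ} (hα : Int.fract α ≠ 0) :
    ‖trapK c M L α‖ ≤
      (4 * (L : ℝ))⁻¹ * ((Int.fract α ^ 2)⁻¹ + ((1 - Int.fract α) ^ 2)⁻¹) := by
  have hL' : (0 : ℝ) < L := by exact_mod_cast hL
  have h0 : 0 < Int.fract α := lt_of_le_of_ne (Int.fract_nonneg α) (Ne.symm hα)
  have h1 : Int.fract α < 1 := Int.fract_lt_one α
  have hsin : 0 < Real.sin (π * Int.fract α) :=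
    Real.sin_pos_of_pos_of_lt_pi (by positivity) (by nlinarith [Real.pi_pos])
  have hsq : ‖e α - 1‖ ^ 2 = 4 * Real.sin (π * Int.fract α) ^ 2 := norm_e_sub_one_sq _
  have hne : e α ≠ 1 := by
    intro h
    rw [h, sub_self, norm_zero, zero_pow two_ne_zero] at hsq
    nlinarith
  calc ‖trapK c M L α‖ ≤ 4 / (L * ‖e α - 1‖ ^ 2) := norm_trapK_le c M L hL hne
    _ = (L : ℝ)⁻¹ * (Real.sin (π * Int.fract α) ^ 2)⁻¹ := by
        rw [hsq]; field_simp
    _ ≤ (L : ℝ)⁻¹ * (4⁻¹ * ((Int.fract α ^ 2)⁻¹ + ((1 - Int.fract α) ^ 2)⁻¹)) :=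
        mul_le_mul_of_nonneg_left (inv_sin_sq_le h0 h1) (by positivity)
    _ = (4 * (L : ℝ))⁻¹ * ((Int.fract α ^ 2)⁻¹ + ((1 - Int.fract α) ^ 2)⁻¹) := by
        rw [mul_inv]; ring

end Kernel

/-- Splitting a doubly bounded quantity: if `0 ≤ x ≤ A` and `x ≤ p + q` with `p, q ≥ 0` then
`x ≤ min(A, p) + min(A, q)`. [folklore] -/
theorem le_min_add_min {x A p q : ℝ} (hx : 0 ≤ x) (hA : x ≤ A) (hpq : x ≤ p + q) (hp : 0 ≤ p)
    (hq : 0 ≤ q) : x ≤ min A p + min A q := by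
  rcases le_total p A with h1 | h1 <;> rcases le_total q A with h2 | h2
  · rw [min_eq_right h1, min_eq_right h2]; exact hpq
  · rw [min_eq_right h1, min_eq_left h2]; linarith
  · rw [min_eq_left h1, min_eq_right h2]; linarith
  · rw [min_eq_left h1, min_eq_left h2]; linarith

/-! ### Separated sets of positive reals and sums of `min(A₀, C/t²)` -/

/-- In a `δ`-separated finite set of positive reals the maximum exceeds `(#T − 1)δ`. [folklore] -/
theorem card_sub_one_mul_lt_max_of_separated {δ : ℝ} (T : Finset ℝ) (hT : ∀ t ∈ T, 0 < t)
    (hsep : ∀ t ∈ T, ∀ t' ∈ T, t ≠ t' → δ ≤ |t - t'|) (hne : T.Nonempty) :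
    ((#T : ℝ) - 1) * δ < T.max' hne := by
  classical
  induction T using Finset.induction_on_max with
  | empty => exact absurd hne (by simp)
  | insert a s ha ih =>
    have hmax : (insert a s).max' hne = a := by
      refine le_antisymm (Finset.max'_le _ _ _ fun x hx => ?_) (le_max' _ _ (mem_insert_self a s))
      rcases mem_insert.1 hx with rfl | hx
      · exact le_rfl
      · exact (ha x hx).le
    have has : a ∉ s := fun h => lt_irrefl a (ha a h)
    rw [hmax, card_insert_of_notMem has]
    rcases s.eq_empty_or_nonempty with rfl | hsne
    · simpa using hT a (mem_insert_self a _)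
    · have ih' := ih (fun t ht => hT t (mem_insert_of_mem ht))
        (fun t ht t' ht' => hsep t (mem_insert_of_mem ht) t' (mem_insert_of_mem ht')) hsne
      have hm : s.max' hsne ∈ s := max'_mem s hsne
      have hlt : s.max' hsne < a := ha _ hm
      have hgap : δ ≤ |a - s.max' hsne| :=
        hsep a (mem_insert_self a s) _ (mem_insert_of_mem hm) hlt.ne'
      rw [abs_of_pos (sub_pos.2 hlt)] at hgap
      push_cast
      linarith

/-- The comparison sequence `ψ_0 = A₀`, `ψ_k = min(A₀, C/(kδ)²)` (`k ≥ 1`). [folklore] -/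
def psiSeq (A₀ C δ : ℝ) (k : ℕ) : ℝ :=
  if k = 0 then A₀ else min A₀ (C * (((k : ℝ) * δ) ^ 2)⁻¹)

/-- `0 ≤ ψ_k ≤ A₀` for `A₀, C ≥ 0`. [folklore] -/
theorem psiSeq_nonneg_le {A₀ C : ℝ} (hA : 0 ≤ A₀) (hC : 0 ≤ C) (δ : ℝ) (k : ℕ) :
    0 ≤ psiSeq A₀ C δ k ∧ psiSeq A₀ C δ k ≤ A₀ := by
  unfold psiSeq
  split_ifs
  · exact ⟨hA, le_rfl⟩
  · exact ⟨le_min hA (by positivity), min_le_left _ _⟩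

/-- **Rearrangement**: for a `δ`-separated finite set `T` of positive reals,
`∑_{t ∈ T} min(A₀, C/t²) ≤ ∑_{k < #T} ψ_k` (the `k`-th smallest element exceeds `(k−1)δ`… in the
form: the largest exceeds `(#T − 1)δ`, inductively). [folklore] -/
theorem sum_min_le_sum_range_psiSeq {δ A₀ C : ℝ} (hδ : 0 < δ) (hC : 0 ≤ C)
    (T : Finset ℝ) (hT : ∀ t ∈ T, 0 < t)
    (hsep : ∀ t ∈ T, ∀ t' ∈ T, t ≠ t' → δ ≤ |t - t'|) :
    ∑ t ∈ T, min A₀ (C * (t ^ 2)⁻¹) ≤ ∑ k ∈ range #T, psiSeq A₀ C δ k := by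
  classical
  induction T using Finset.induction_on_max with
  | empty => simp
  | insert a s ha ih =>
    have has : a ∉ s := fun h => lt_irrefl a (ha a h)
    have hT' : ∀ t ∈ s, 0 < t := fun t ht => hT t (mem_insert_of_mem ht)
    have hsep' : ∀ t ∈ s, ∀ t' ∈ s, t ≠ t' → δ ≤ |t - t'| :=
      fun t ht t' ht' => hsep t (mem_insert_of_mem ht) t' (mem_insert_of_mem ht')
    rw [sum_insert has, card_insert_of_notMem has, sum_range_succ, add_comm]
    refine add_le_add (ih hT' hsep') ?_
    rcases Nat.eq_zero_or_pos #s with h0 | hpos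
    · rw [h0, psiSeq, if_pos rfl]; exact min_le_left _ _
    · have hne : (insert a s).Nonempty := insert_nonempty a s
      have hmax : (insert a s).max' hne = a := by
        refine le_antisymm (Finset.max'_le _ _ _ fun x hx => ?_)
          (le_max' _ _ (mem_insert_self a s))
        rcases mem_insert.1 hx with rfl | hx
        · exact le_rfl
        · exact (ha x hx).le
      have hV := card_sub_one_mul_lt_max_of_separated (insert a s) hT hsep hne
      rw [hmax, card_insert_of_notMem has] at hV
      push_cast at hV
      have hV' : (#s : ℝ) * δ < a := by linarith
      have hkδ : 0 < (#s : ℝ) * δ := by positivity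
      rw [psiSeq, if_neg hpos.ne']
      refine min_le_min le_rfl (mul_le_mul_of_nonneg_left ?_ hC)
      exact inv_anti₀ (by positivity) (pow_le_pow_left₀ hkδ.le hV'.le 2)

/-- **Tail bound**: `∑_{k < n} ψ_k ≤ A₀(J + 1) + 2C/(δ²(J + 1))` for every `J` (the terms `k ≤ J`
are at most `A₀`, and `∑_{k > J} k⁻² ≤ 2/(J + 1)`). [folklore] -/
theorem sum_range_psiSeq_le {δ A₀ C : ℝ} (hδ : 0 < δ) (hA : 0 ≤ A₀) (hC : 0 ≤ C) (n J : ℕ) :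
    ∑ k ∈ range n, psiSeq A₀ C δ k ≤ A₀ * (J + 1) + 2 * C / (δ ^ 2 * (J + 1)) := by
  rw [← sum_filter_add_sum_filter_not (range n) (fun k => k ≤ J)]
  refine add_le_add ?_ ?_
  · calc ∑ k ∈ (range n).filter (fun k => k ≤ J), psiSeq A₀ C δ k
        ≤ ∑ k ∈ (range n).filter (fun k => k ≤ J), A₀ :=
          sum_le_sum fun k _ => (psiSeq_nonneg_le hA hC δ k).2
      _ = #((range n).filter (fun k => k ≤ J)) * A₀ := by rw [sum_const, nsmul_eq_mul]
      _ ≤ ((J + 1 : ℕ) : ℝ) * A₀ := by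
          refine mul_le_mul_of_nonneg_right ?_ hA
          have hsub : (range n).filter (fun k => k ≤ J) ⊆ range (J + 1) := by
            intro k hk
            simp only [mem_filter, mem_range] at hk ⊢
            omega
          exact_mod_cast (card_le_card hsub).trans (card_range (J + 1)).le
      _ = A₀ * (J + 1) := by push_cast; ring
  · have hset : (range n).filter (fun k => ¬k ≤ J) = Ioo J n := by
      ext k
      simp only [mem_filter, mem_range, mem_Ioo]
      omega
    rw [hset]
    have hk : ∀ k ∈ Ioo J n, psiSeq A₀ C δ k ≤ C / δ ^ 2 * ((k : ℝ) ^ 2)⁻¹ := by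
      intro k hk
      rw [mem_Ioo] at hk
      have hk0 : k ≠ 0 := by omega
      rw [psiSeq, if_neg hk0]
      refine (min_le_right _ _).trans (le_of_eq ?_)
      rw [mul_pow, mul_inv]
      field_simp
    calc ∑ k ∈ Ioo J n, psiSeq A₀ C δ k ≤ ∑ k ∈ Ioo J n, C / δ ^ 2 * ((k : ℝ) ^ 2)⁻¹ :=
          sum_le_sum hk
      _ = C / δ ^ 2 * ∑ k ∈ Ioo J n, ((k : ℝ) ^ 2)⁻¹ := by rw [mul_sum]
      _ ≤ C / δ ^ 2 * (2 / (J + 1)) := by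
          refine mul_le_mul_of_nonneg_left ?_ (by positivity)
          exact_mod_cast sum_Ioo_inv_sq_le (α := ℝ) J n
      _ = 2 * C / (δ ^ 2 * (J + 1)) := by
          field_simp

/-- **Spacing lemma with a ceiling**: for a `δ`-separated finite set `T` of positive reals and
`A₀, C ≥ 0`, `∑_{t ∈ T} min(A₀, C/t²) ≤ A₀(J + 1) + 2C/(δ²(J + 1))` for every `J ∈ ℕ`. [folklore] -/
theorem sum_min_inv_sq_le_of_separated {δ A₀ C : ℝ} (hδ : 0 < δ) (hA : 0 ≤ A₀) (hC : 0 ≤ C)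
    (T : Finset ℝ) (hT : ∀ t ∈ T, 0 < t)
    (hsep : ∀ t ∈ T, ∀ t' ∈ T, t ≠ t' → δ ≤ |t - t'|) (J : ℕ) :
    ∑ t ∈ T, min A₀ (C * (t ^ 2)⁻¹) ≤ A₀ * (J + 1) + 2 * C / (δ ^ 2 * (J + 1)) :=
  (sum_min_le_sum_range_psiSeq hδ hC T hT hsep).trans (sum_range_psiSeq_le hδ hA hC _ J)

/-- Injective-image form of the spacing lemma with a ceiling: if `g > 0` on `A` and the values of `g`
on `A` are `δ`-separated, then `∑_{s ∈ A} min(A₀, C/g(s)²) ≤ A₀(J + 1) + 2C/(δ²(J + 1))`. [folklore] -/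
theorem sum_min_inv_sq_apply_le_of_separated {ι : Type*} {δ A₀ C : ℝ} (hδ : 0 < δ) (hA : 0 ≤ A₀)
    (hC : 0 ≤ C) (A : Finset ι) (g : ι → ℝ) (h1 : ∀ s ∈ A, 0 < g s)
    (h2 : ∀ s ∈ A, ∀ s' ∈ A, s ≠ s' → δ ≤ |g s - g s'|) (J : ℕ) :
    ∑ s ∈ A, min A₀ (C * (g s ^ 2)⁻¹) ≤ A₀ * (J + 1) + 2 * C / (δ ^ 2 * (J + 1)) := by
  classical
  have hinj : Set.InjOn g A := by
    intro s hs s' hs' hg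
    by_contra hne
    have := h2 s hs s' hs' hne
    rw [hg, sub_self, abs_zero] at this
    exact absurd this (not_le.2 hδ)
  rw [← Finset.sum_image (f := fun t : ℝ => min A₀ (C * (t ^ 2)⁻¹)) hinj]
  refine sum_min_inv_sq_le_of_separated hδ hA hC _ ?_ ?_ J
  · intro t ht
    obtain ⟨s, hs, rfl⟩ := mem_image.1 ht
    exact h1 s hs
  · intro t ht t' ht' hne
    obtain ⟨s, hs, rfl⟩ := mem_image.1 ht
    obtain ⟨s', hs', rfl⟩ := mem_image.1 ht'
    exact h2 s hs s' hs' fun h => hne (by rw [h])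


/-! ### Lemma A: a free coordinate — `∑_{b mod q} |K(b/q − c)| ≪ N + q` -/

/-- Integers `b, b' ∈ [0, q)` with `b − b' ∈ qℤ` are equal. [folklore] -/
theorem eq_of_sub_eq_mul_of_mem_Ico {q : ℕ} {b b' n : ℤ} (hb : b ∈ Ico (0 : ℤ) q)
    (hb' : b' ∈ Ico (0 : ℤ) q) (hn : b - b' = n * q) : b = b' := by
  rw [mem_Ico] at hb hb'
  rcases lt_trichotomy n 0 with hn0 | rfl | hn0
  · nlinarith
  · linarith
  · nlinarith

/-- The points `b/q − c`, `0 ≤ b < q`, are `1/q`-separated modulo one: their fractional parts are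
`1/q`-separated. [folklore] -/
theorem fract_div_sub_separated {q : ℕ} (hq : 0 < q) (c : ℝ) {b b' : ℤ} (hb : b ∈ Ico (0 : ℤ) q)
    (hb' : b' ∈ Ico (0 : ℤ) q) (hne : b ≠ b') :
    (q : ℝ)⁻¹ ≤ |Int.fract ((b : ℝ) / q - c) - Int.fract ((b' : ℝ) / q - c)| := by
  have hq' : (0 : ℝ) < q := by exact_mod_cast hq
  obtain ⟨n, hn⟩ : ∃ n : ℤ, n = ⌊(b : ℝ) / q - c⌋ - ⌊(b' : ℝ) / q - c⌋ := ⟨_, rfl⟩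
  have e1 : Int.fract ((b : ℝ) / q - c) - Int.fract ((b' : ℝ) / q - c) =
      ((b - b' - n * q : ℤ) : ℝ) / q := by
    rw [← Int.self_sub_floor, ← Int.self_sub_floor]
    have h2 : ((n : ℤ) : ℝ) = (⌊(b : ℝ) / q - c⌋ : ℝ) - (⌊(b' : ℝ) / q - c⌋ : ℝ) := by
      rw [hn]; push_cast; ring
    rw [show (b : ℝ) / q - c - (⌊(b : ℝ) / q - c⌋ : ℝ) - ((b' : ℝ) / q - c - (⌊(b' : ℝ) / q - c⌋ : ℝ)) =
      ((b : ℝ) / q - (b' : ℝ) / q) - (n : ℝ) by rw [h2]; ring]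
    push_cast
    field_simp
  have hm : (b - b' - n * q : ℤ) ≠ 0 := by
    intro h0
    exact hne (eq_of_sub_eq_mul_of_mem_Ico hb hb' (n := n) (by linarith))
  have h1 : (1 : ℝ) ≤ |((b - b' - n * q : ℤ) : ℝ)| := by
    rw [← Int.cast_abs]; exact_mod_cast Int.one_le_abs hm
  rw [e1, abs_div, abs_of_pos hq', le_div_iff₀ hq', inv_mul_cancel₀ hq'.ne']
  exact h1

/-- **Lemma A** (a free coordinate): for `q ≥ 1`, real `c` and every `J ∈ ℕ`,
`∑_{0 ≤ b < q} |K(b/q − c)| ≤ (2M + L)(2J + 3) + q²/(L(J + 1))`: at most one `b` has `b/q − c ∈ ℤ`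
(bound `2M + L`); for the others `|K| ≤ min(2M+L, (4L)⁻¹v⁻²) + min(2M+L, (4L)⁻¹(1−v)⁻²)` with the
fractional parts `v` (and `1 − v`) `1/q`-separated, and the spacing lemma with a ceiling applies.
With `L = N` and `J = ⌊q/N⌋` this is `≪ N + q`. [folklore] -/
theorem sum_norm_trapK_div_sub_le (cc : ℤ) (M L : ℕ) (hL : 0 < L) {q : ℕ} (hq : 0 < q) (c : ℝ)
    (J : ℕ) :
    ∑ b ∈ Ico (0 : ℤ) q, ‖trapK cc M L ((b : ℝ) / q - c)‖ ≤
      ((2 * M + L : ℕ) : ℝ) * (2 * J + 3) + (q : ℝ) ^ 2 / (L * (J + 1)) := by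
  classical
  have hL' : (0 : ℝ) < L := by exact_mod_cast hL
  have hq' : (0 : ℝ) < q := by exact_mod_cast hq
  set A₀ : ℝ := ((2 * M + L : ℕ) : ℝ) with hA₀
  have hA0 : 0 ≤ A₀ := by positivity
  set C : ℝ := (4 * (L : ℝ))⁻¹ with hC
  have hC0 : 0 ≤ C := by positivity
  set B₀ : Finset ℤ := (Ico (0 : ℤ) q).filter (fun b : ℤ => Int.fract ((b : ℝ) / q - c) = 0)
    with hB₀
  set B' : Finset ℤ := (Ico (0 : ℤ) q).filter (fun b : ℤ => ¬Int.fract ((b : ℝ) / q - c) = 0)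
    with hB'
  -- at most one `b` with `b/q - c ∈ ℤ`
  have hcard : #B₀ ≤ 1 := by
    rw [Finset.card_le_one]
    intro b hb b' hb'
    rw [hB₀, mem_filter] at hb hb'
    by_contra hne
    have h := fract_div_sub_separated (b := b) (b' := b') hq c hb.1 hb'.1 hne
    rw [hb.2, hb'.2, sub_zero, abs_zero] at h
    exact absurd h (not_le.2 (inv_pos.2 hq'))
  have hsum0 : ∑ b ∈ B₀, ‖trapK cc M L ((b : ℝ) / q - c)‖ ≤ A₀ := by
    calc ∑ b ∈ B₀, ‖trapK cc M L ((b : ℝ) / q - c)‖ ≤ ∑ b ∈ B₀, A₀ :=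
          sum_le_sum fun b _ => norm_trapK_le_sum cc M L hL _
      _ = #B₀ * A₀ := by rw [sum_const, nsmul_eq_mul]
      _ ≤ 1 * A₀ := by gcongr; exact_mod_cast hcard
      _ = A₀ := one_mul _
  -- pointwise split on `B'`
  have hpt : ∀ b ∈ B', ‖trapK cc M L ((b : ℝ) / q - c)‖ ≤
      min A₀ (C * (Int.fract ((b : ℝ) / q - c) ^ 2)⁻¹) +
        min A₀ (C * ((1 - Int.fract ((b : ℝ) / q - c)) ^ 2)⁻¹) := by
    intro b hb
    rw [hB', mem_filter] at hb
    refine le_min_add_min (norm_nonneg _) (norm_trapK_le_sum cc M L hL _) ?_ (by positivity)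
      (by positivity)
    rw [← mul_add]
    exact norm_trapK_le_fract cc M L hL hb.2
  have hpos1 : ∀ b ∈ B', 0 < Int.fract ((b : ℝ) / q - c) := fun b hb => by
    rw [hB', mem_filter] at hb
    exact lt_of_le_of_ne (Int.fract_nonneg _) (Ne.symm hb.2)
  have hpos2 : ∀ b ∈ B', 0 < 1 - Int.fract ((b : ℝ) / q - c) := fun b _ => by
    linarith [Int.fract_lt_one ((b : ℝ) / q - c)]
  have hsep1 : ∀ b : ℤ, b ∈ B' → ∀ b' : ℤ, b' ∈ B' → b ≠ b' →
      (q : ℝ)⁻¹ ≤ |Int.fract ((b : ℝ) / q - c) - Int.fract ((b' : ℝ) / q - c)| :=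
    fun b hb b' hb' hne =>
      fract_div_sub_separated (b := b) (b' := b') hq c (mem_of_mem_filter b hb)
        (mem_of_mem_filter b' hb') hne
  have hsep2 : ∀ b : ℤ, b ∈ B' → ∀ b' : ℤ, b' ∈ B' → b ≠ b' →
      (q : ℝ)⁻¹ ≤ |(1 - Int.fract ((b : ℝ) / q - c)) - (1 - Int.fract ((b' : ℝ) / q - c))| := by
    intro b hb b' hb' hne
    rw [show (1 - Int.fract ((b : ℝ) / q - c)) - (1 - Int.fract ((b' : ℝ) / q - c)) =
      -(Int.fract ((b : ℝ) / q - c) - Int.fract ((b' : ℝ) / q - c)) by ring, abs_neg]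
    exact hsep1 b hb b' hb' hne
  have hS1 := sum_min_inv_sq_apply_le_of_separated (inv_pos.2 hq') hA0 hC0 B'
    (fun b => Int.fract ((b : ℝ) / q - c)) hpos1 hsep1 J
  have hS2 := sum_min_inv_sq_apply_le_of_separated (inv_pos.2 hq') hA0 hC0 B'
    (fun b => 1 - Int.fract ((b : ℝ) / q - c)) hpos2 hsep2 J
  have hval : 2 * C / ((q : ℝ)⁻¹ ^ 2 * (J + 1)) = (q : ℝ) ^ 2 / (2 * L * (J + 1)) := by
    rw [hC]; field_simp; ring
  rw [hval] at hS1 hS2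
  calc ∑ b ∈ Ico (0 : ℤ) q, ‖trapK cc M L ((b : ℝ) / q - c)‖
      = ∑ b ∈ B₀, ‖trapK cc M L ((b : ℝ) / q - c)‖ +
          ∑ b ∈ B', ‖trapK cc M L ((b : ℝ) / q - c)‖ := by
        rw [hB₀, hB', sum_filter_add_sum_filter_not]
    _ ≤ A₀ + ∑ b ∈ B', (min A₀ (C * (Int.fract ((b : ℝ) / q - c) ^ 2)⁻¹) +
          min A₀ (C * ((1 - Int.fract ((b : ℝ) / q - c)) ^ 2)⁻¹)) :=
        add_le_add hsum0 (sum_le_sum hpt)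
    _ = A₀ + (∑ b ∈ B', min A₀ (C * (Int.fract ((b : ℝ) / q - c) ^ 2)⁻¹) +
          ∑ b ∈ B', min A₀ (C * ((1 - Int.fract ((b : ℝ) / q - c)) ^ 2)⁻¹)) := by
        rw [sum_add_distrib]
    _ ≤ A₀ + ((A₀ * (J + 1) + (q : ℝ) ^ 2 / (2 * L * (J + 1))) +
          (A₀ * (J + 1) + (q : ℝ) ^ 2 / (2 * L * (J + 1)))) :=
        add_le_add le_rfl (add_le_add hS1 hS2)
    _ = A₀ * (2 * J + 3) + (q : ℝ) ^ 2 / (L * (J + 1)) := by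
        field_simp; ring

/-- Lemma A with the choice `L ≥ 1`, `2M + L ≤ 2N`, `J = ⌊q/N⌋`: `∑_{b mod q} |K(b/q − c)| ≤ 6(N + q)`
— actually `≤ 5q + 6N`; we record `6(N + q)`. [folklore] -/
theorem sum_norm_trapK_div_sub_le' (cc : ℤ) (M L N : ℕ) (hN : 0 < N) (hLN : L = N)
    (hA : 2 * M + L ≤ 2 * N) {q : ℕ} (hq : 0 < q) (c : ℝ) :
    ∑ b ∈ Ico (0 : ℤ) q, ‖trapK cc M L ((b : ℝ) / q - c)‖ ≤ 6 * ((N : ℝ) + q) := by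
  have hN' : (0 : ℝ) < N := by exact_mod_cast hN
  have hq' : (0 : ℝ) < q := by exact_mod_cast hq
  have hL : 0 < L := by omega
  have h := sum_norm_trapK_div_sub_le cc M L hL hq c (q / N)
  have hA' : ((2 * M + L : ℕ) : ℝ) ≤ 2 * N := by exact_mod_cast hA
  -- `J = ⌊q/N⌋`: `J ≤ q/N` and `q/N < J + 1`
  have hJ1 : ((q / N : ℕ) : ℝ) ≤ (q : ℝ) / N := Nat.cast_div_le
  have hJ2 : (q : ℝ) < (((q / N : ℕ) : ℝ) + 1) * N := by
    have h0 := Nat.lt_div_mul_add (a := q) hN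
    calc (q : ℝ) < ((q / N * N + N : ℕ) : ℝ) := by exact_mod_cast h0
      _ = (((q / N : ℕ) : ℝ) + 1) * N := by push_cast; ring
  have hJ1' : ((q / N : ℕ) : ℝ) * N ≤ q := by rwa [le_div_iff₀ hN'] at hJ1
  -- first term: `(2M+L)(2J+3) ≤ 2N(2J+3) = 4 N J + 6 N ≤ 4 q + 6 N`
  have h1 : ((2 * M + L : ℕ) : ℝ) * (2 * (q / N : ℕ) + 3) ≤ 4 * q + 6 * N := by
    calc ((2 * M + L : ℕ) : ℝ) * (2 * (q / N : ℕ) + 3) ≤ (2 * N) * (2 * (q / N : ℕ) + 3) :=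
          mul_le_mul_of_nonneg_right hA' (by positivity)
      _ = 4 * (((q / N : ℕ) : ℝ) * N) + 6 * N := by ring
      _ ≤ 4 * q + 6 * N := by linarith
  -- second term: `q²/(N(J+1)) ≤ q` since `q ≤ N (J+1)`
  have h2 : (q : ℝ) ^ 2 / (L * ((q / N : ℕ) + 1)) ≤ q := by
    rw [hLN, div_le_iff₀ (by positivity)]
    have : (q : ℝ) ≤ N * ((q / N : ℕ) + 1) := by linarith
    calc (q : ℝ) ^ 2 = q * q := sq _
      _ ≤ q * (N * ((q / N : ℕ) + 1)) := mul_le_mul_of_nonneg_left this hq'.le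
  linarith

/-! ### Lemma B: the distinguished coordinate — `∑_{Q<q≤2Q} ∑_{b/q ≠ a/r} |K(b/q − a/r)| ≪ Q²` -/

/-- **Counting `q` in a residue condition**: for `Q < r`, `d = gcd(a, r)` and any integer `s`, at most
`d + 1` integers `q ∈ (Q, 2Q]` satisfy `r ∣ aq + s` (they are congruent modulo `r/d > (Q − 1)/d`).
[folklore] -/
theorem card_Ioc_filter_dvd_le {Q r : ℕ} (hQr : Q < r) (a s : ℤ) :
    #((Ioc Q (2 * Q)).filter (fun q : ℕ => (r : ℤ) ∣ a * q + s)) ≤ Int.gcd a r + 1 := by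
  classical
  rcases Nat.eq_zero_or_pos Q with hQ0 | hQ0
  · subst hQ0; simp
  set d : ℕ := Int.gcd a r with hd
  have hr0 : 0 < r := by omega
  have hd0 : 0 < d := Int.gcd_pos_of_ne_zero_right _ (by exact_mod_cast hr0.ne')
  -- `a = d a'`, `r = d r'` with `a', r'` coprime
  obtain ⟨a', ha'⟩ : ((d : ℕ) : ℤ) ∣ a := Int.gcd_dvd_left a r
  have hdr : (d : ℕ) ∣ r := by
    have := Int.gcd_dvd_right a r
    exact_mod_cast this
  obtain ⟨r', hr'⟩ := hdr
  have hr'0 : 0 < r' := by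
    rcases Nat.eq_zero_or_pos r' with h | h
    · rw [h, mul_zero] at hr'; omega
    · exact h
  have hcop : IsCoprime (r' : ℤ) a' := by
    rw [Int.isCoprime_iff_gcd_eq_one]
    have h1 : Int.gcd (a / d) (r / d) = 1 := Int.gcd_div_gcd_div_gcd (by exact_mod_cast hd0)
    have h2 : a / d = a' := by
      rw [ha']; exact Int.mul_ediv_cancel_left _ (by exact_mod_cast hd0.ne')
    have h3 : (r : ℤ) / d = r' := by
      rw [hr']; push_cast; exact Int.mul_ediv_cancel_left _ (by exact_mod_cast hd0.ne')
    rw [h2, h3] at h1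
    rw [Int.gcd_comm]; exact h1
  set S := (Ioc Q (2 * Q)).filter (fun q : ℕ => (r : ℤ) ∣ a * q + s) with hS
  -- elements of `S` are congruent modulo `r'`
  have hmod : ∀ q ∈ S, ∀ q' ∈ S, q % r' = q' % r' := by
    intro q hq q' hq'
    rw [hS, mem_filter] at hq hq'
    obtain ⟨u, hu⟩ := hq.2
    obtain ⟨u', hu'⟩ := hq'.2
    -- `r ∣ a (q - q')`, so `r' ∣ a' (q - q')`, so `r' ∣ q - q'`
    have h1 : (r' : ℤ) * (d * (u - u')) = a' * (d * ((q : ℤ) - q')) := by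
      have e1 : a * q - a * q' = (r : ℤ) * (u - u') := by rw [mul_sub, ← hu, ← hu']; ring
      have e2 : (r : ℤ) = d * r' := by rw [hr']; push_cast; ring
      rw [ha', e2] at e1
      linear_combination -e1
    have h2 : (r' : ℤ) ∣ a' * ((q : ℤ) - q') := by
      refine ⟨u - u', ?_⟩
      have hd0' : (d : ℤ) ≠ 0 := by exact_mod_cast hd0.ne'
      have := h1
      rw [mul_left_comm] at this
      rw [mul_left_comm (a' : ℤ)] at this
      exact (mul_left_cancel₀ hd0' this).symm ▸ by ring
    have h3 : (r' : ℤ) ∣ (q : ℤ) - q' := hcop.dvd_of_dvd_mul_left h2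
    have h4 : q' ≡ q [MOD r'] := Nat.modEq_iff_dvd.mpr (by
      have : (r' : ℤ) ∣ (q : ℤ) - q' := h3
      exact_mod_cast this)
    exact h4.symm
  -- the map `q ↦ q / r'` is injective on `S` and lands in `[(Q+1)/r', 2Q/r']`
  have hinj : Set.InjOn (fun q : ℕ => q / r') S := by
    intro q hq q' hq' h
    have e1 := Nat.div_add_mod q r'
    have e2 := Nat.div_add_mod q' r'
    simp only at h
    rw [← e1, ← e2, h, hmod q hq q' hq']
  have himg : S.image (fun q : ℕ => q / r') ⊆ Icc ((Q + 1) / r') (2 * Q / r') := by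
    intro t ht
    obtain ⟨q, hq, rfl⟩ := mem_image.1 ht
    rw [hS, mem_filter, mem_Ioc] at hq
    rw [mem_Icc]
    exact ⟨Nat.div_le_div_right (by omega), Nat.div_le_div_right hq.1.2⟩
  calc #S = #(S.image (fun q : ℕ => q / r')) := (card_image_of_injOn hinj).symm
    _ ≤ #(Icc ((Q + 1) / r') (2 * Q / r')) := card_le_card himg
    _ = 2 * Q / r' + 1 - (Q + 1) / r' := Nat.card_Icc _ _
    _ ≤ d + 1 := by
        have h1 : 2 * Q / r' ≤ (Q + 1) / r' + (Q - 1) / r' + 1 := by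
          have : 2 * Q = (Q + 1) + (Q - 1) := by omega
          rw [this, Nat.add_div hr'0]
          split_ifs <;> omega
        have h2 : (Q - 1) / r' < d := by
          rw [Nat.div_lt_iff_lt_mul hr'0]
          rw [hr'] at hQr
          omega
        omega

section LemmaB

variable {Q r : ℕ} {a : ℤ}

/-- The index set of Lemma B: pairs `(q, b)` with `Q < q ≤ 2Q`, `0 ≤ b < q`, `b/q ≠ a/r`. [folklore] -/
def pairsB (Q r : ℕ) (a : ℤ) : Finset ((_ : ℕ) × ℤ) :=
  (Ioc Q (2 * Q)).sigma fun q => (Ico (0 : ℤ) q).filter (fun b : ℤ => b * r ≠ a * q)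

/-- Membership in `pairsB`. [folklore] -/
theorem mem_pairsB {x : (_ : ℕ) × ℤ} :
    x ∈ pairsB Q r a ↔ (Q < x.1 ∧ x.1 ≤ 2 * Q) ∧ (0 ≤ x.2 ∧ x.2 < x.1) ∧ x.2 * r ≠ a * x.1 := by
  simp only [pairsB, mem_sigma, mem_Ioc, mem_filter, mem_Ico]

/-- Fibres of the linear forms `b r − a q − n q r` on `pairsB`: for `Q < r` and any integers `n, s`,
at most `gcd(a, r) + 1` pairs `(q, b)` satisfy `b r − a q − n q r = s` (the value of `q` determines
`b`, and `r ∣ aq + s`). [folklore] -/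
theorem card_pairsB_fibre_le (hQr : Q < r) (n s : ℤ) :
    #((pairsB Q r a).filter (fun x => x.2 * r - a * x.1 - n * (x.1 * r) = s)) ≤ Int.gcd a r + 1 := by
  classical
  have hr0 : (r : ℤ) ≠ 0 := by exact_mod_cast (show r ≠ 0 by omega)
  refine le_trans ?_ (card_Ioc_filter_dvd_le hQr a s)
  refine Finset.card_le_card_of_injOn (fun x => x.1) ?_ ?_
  · intro x hx
    rw [mem_coe, mem_filter, mem_pairsB] at hx
    rw [mem_coe, mem_filter, mem_Ioc]
    refine ⟨hx.1.1, ⟨x.2 - n * x.1, ?_⟩⟩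
    linear_combination -hx.2
  · intro x hx y hy hxy
    rw [mem_coe, mem_filter] at hx hy
    simp only at hxy
    have h2 : x.2 = y.2 := by
      have e : x.2 * r = y.2 * r := by
        have ex := hx.2
        have ey := hy.2
        rw [hxy] at ex
        linear_combination ex - ey
      exact mul_right_cancel₀ hr0 e
    exact Sigma.ext hxy (heq_of_eq h2)

/-- The generic fibre-counting estimate behind Lemma B: if `σ > 0` on `P`, `σ ≤ T₀`, `d ∣ σ` and every
fibre of `σ` has at most `m` elements, then for `A₀, E ≥ 0` and every `J`,
`∑_{x ∈ P} min(A₀, E/σ(x)²) ≤ m (A₀ J + 2(E/d²)/(J + 1))`. [folklore] -/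
theorem sum_min_fibre_le {ι : Type*} [DecidableEq ι] (P : Finset ι) (σ : ι → ℤ) {d : ℕ} (hd : 0 < d)
    (T₀ : ℕ) (hpos : ∀ x ∈ P, 0 < σ x) (hle : ∀ x ∈ P, σ x ≤ T₀) (hdvd : ∀ x ∈ P, (d : ℤ) ∣ σ x)
    {m : ℕ} (hfib : ∀ s : ℤ, #(P.filter (fun x => σ x = s)) ≤ m) {A₀ E : ℝ} (hA : 0 ≤ A₀)
    (hE : 0 ≤ E) (J : ℕ) :
    ∑ x ∈ P, min A₀ (E * (((σ x : ℤ) : ℝ) ^ 2)⁻¹) ≤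
      m * (A₀ * J + 2 * (E / (d : ℝ) ^ 2) / (J + 1)) := by
  have hd' : (0 : ℝ) < d := by exact_mod_cast hd
  set θ : ℤ → ℝ := fun s => min A₀ (E * (((s : ℤ) : ℝ) ^ 2)⁻¹) with hθ
  have hθ0 : ∀ s, 0 ≤ θ s := fun s => le_min hA (by positivity)
  -- step 1: insert the sum over `t = σ(x)/d ∈ [1, T₀]`
  have step1 : ∀ x ∈ P, θ (σ x) ≤
      ∑ t ∈ Icc 1 T₀, (if σ x = d * t then θ ((d : ℤ) * t) else 0) := by
    intro x hx
    obtain ⟨t, ht⟩ := hdvd x hx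
    have ht0 : 0 < t := by
      have := hpos x hx; rw [ht] at this
      exact pos_of_mul_pos_right this (by positivity)
    obtain ⟨tn, rfl⟩ : ∃ tn : ℕ, (tn : ℤ) = t := ⟨t.toNat, Int.toNat_of_nonneg ht0.le⟩
    have htn : tn ∈ Icc 1 T₀ := by
      rw [mem_Icc]
      constructor
      · exact_mod_cast ht0
      · have h1 : σ x ≤ T₀ := hle x hx
        have h2 : (tn : ℤ) ≤ d * tn := le_mul_of_one_le_left (by positivity) (by exact_mod_cast hd)
        have : (tn : ℤ) ≤ T₀ := by rw [ht] at h1; exact h2.trans h1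
        exact_mod_cast this
    calc θ (σ x) = (if σ x = d * (tn : ℤ) then θ ((d : ℤ) * tn) else 0) := by
          rw [if_pos ht, ← ht]
      _ ≤ ∑ t ∈ Icc 1 T₀, (if σ x = d * (t : ℤ) then θ ((d : ℤ) * t) else 0) :=
          single_le_sum (f := fun t : ℕ => if σ x = d * (t : ℤ) then θ ((d : ℤ) * t) else 0)
            (fun t _ => by split_ifs; exacts [hθ0 _, le_rfl]) htn
  -- step 2: swap and count fibres
  have step2 : ∀ t : ℕ, ∑ x ∈ P, (if σ x = d * (t : ℤ) then θ ((d : ℤ) * t) else 0) ≤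
      m * θ ((d : ℤ) * t) := by
    intro t
    rw [← sum_filter, sum_const, nsmul_eq_mul]
    exact mul_le_mul_of_nonneg_right (by exact_mod_cast hfib _) (hθ0 _)
  -- step 3: the sum over `t`
  have step3 : ∑ t ∈ Icc 1 T₀, θ ((d : ℤ) * t) ≤ A₀ * J + 2 * (E / (d : ℝ) ^ 2) / (J + 1) := by
    rw [← sum_filter_add_sum_filter_not (Icc 1 T₀) (fun t => t ≤ J)]
    refine add_le_add ?_ ?_
    · calc ∑ t ∈ (Icc 1 T₀).filter (fun t => t ≤ J), θ ((d : ℤ) * t)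
          ≤ ∑ t ∈ (Icc 1 T₀).filter (fun t => t ≤ J), A₀ :=
            sum_le_sum fun t _ => min_le_left _ _
        _ = #((Icc 1 T₀).filter (fun t => t ≤ J)) * A₀ := by rw [sum_const, nsmul_eq_mul]
        _ ≤ (J : ℝ) * A₀ := by
            refine mul_le_mul_of_nonneg_right ?_ hA
            have hsub : (Icc 1 T₀).filter (fun t => t ≤ J) ⊆ Icc 1 J := by
              intro t ht
              simp only [mem_filter, mem_Icc] at ht ⊢
              omega
            have := (card_le_card hsub).trans (Nat.card_Icc 1 J).le
            exact_mod_cast (by omega : #((Icc 1 T₀).filter (fun t => t ≤ J)) ≤ J)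
        _ = A₀ * J := mul_comm _ _
    · have hsub : (Icc 1 T₀).filter (fun t => ¬t ≤ J) ⊆ Ioo J (T₀ + 1) := by
        intro t ht
        simp only [mem_filter, mem_Icc, mem_Ioo] at ht ⊢
        omega
      have hpt : ∀ t ∈ (Icc 1 T₀).filter (fun t => ¬t ≤ J),
          θ ((d : ℤ) * t) ≤ E / (d : ℝ) ^ 2 * ((t : ℝ) ^ 2)⁻¹ := by
        intro t ht
        simp only [mem_filter, mem_Icc] at ht
        have ht0 : (0 : ℝ) < t := by exact_mod_cast (by omega : 0 < t)
        refine (min_le_right _ _).trans (le_of_eq ?_)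
        push_cast
        field_simp
      calc ∑ t ∈ (Icc 1 T₀).filter (fun t => ¬t ≤ J), θ ((d : ℤ) * t)
          ≤ ∑ t ∈ (Icc 1 T₀).filter (fun t => ¬t ≤ J), E / (d : ℝ) ^ 2 * ((t : ℝ) ^ 2)⁻¹ :=
            sum_le_sum hpt
        _ ≤ ∑ t ∈ Ioo J (T₀ + 1), E / (d : ℝ) ^ 2 * ((t : ℝ) ^ 2)⁻¹ :=
            sum_le_sum_of_subset_of_nonneg hsub fun t _ _ => by positivity
        _ = E / (d : ℝ) ^ 2 * ∑ t ∈ Ioo J (T₀ + 1), ((t : ℝ) ^ 2)⁻¹ := by rw [mul_sum]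
        _ ≤ E / (d : ℝ) ^ 2 * (2 / (J + 1)) := by
            refine mul_le_mul_of_nonneg_left ?_ (by positivity)
            exact_mod_cast sum_Ioo_inv_sq_le (α := ℝ) J (T₀ + 1)
        _ = 2 * (E / (d : ℝ) ^ 2) / (J + 1) := by ring
  -- combine
  calc ∑ x ∈ P, θ (σ x)
      ≤ ∑ x ∈ P, ∑ t ∈ Icc 1 T₀, (if σ x = d * (t : ℤ) then θ ((d : ℤ) * t) else 0) :=
        sum_le_sum step1
    _ = ∑ t ∈ Icc 1 T₀, ∑ x ∈ P, (if σ x = d * (t : ℤ) then θ ((d : ℤ) * t) else 0) := sum_comm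
    _ ≤ ∑ t ∈ Icc 1 T₀, m * θ ((d : ℤ) * t) := sum_le_sum fun t _ => step2 t
    _ = m * ∑ t ∈ Icc 1 T₀, θ ((d : ℤ) * t) := by rw [mul_sum]
    _ ≤ m * (A₀ * J + 2 * (E / (d : ℝ) ^ 2) / (J + 1)) :=
        mul_le_mul_of_nonneg_left step3 (by positivity)

/-- **Lemma B** (the distinguished coordinate): for `Q < r ≤ 2Q`, `0 ≤ a < r`, `d = gcd(a, r)` and
every `J ∈ ℕ`,
`∑_{Q < q ≤ 2Q} ∑_{0 ≤ b < q, b/q ≠ a/r} |K(b/q − a/r)| ≤ 2 · 2(d+1) · ((2M+L) J + 2(E/d²)/(J+1))` with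
`E = 4Q⁴/L`.  Writing `v = fract(b/q − a/r) ∈ (0, 1)`, one has `|K| ≤ min(A₀, (4L)⁻¹v⁻²) + min(A₀, (4L)⁻¹(1−v)⁻²)`
and `v = s₁/(qr)`, `1 − v = s₂/(qr)` with positive integers `s_i ≤ 4Q²` divisible by `d`; the fibres of
`(q, b) ↦ s_i` have at most `2(d + 1)` elements (`card_pairsB_fibre_le`), and `sum_min_fibre_le` applies.
[folklore] -/
theorem sum_sum_norm_trapK_le (cc : ℤ) (M L : ℕ) (hL : 0 < L) (hQr : Q < r) (hr2 : r ≤ 2 * Q)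
    (ha0 : 0 ≤ a) (har : a < r) (J : ℕ) :
    ∑ q ∈ Ioc Q (2 * Q), ∑ b ∈ (Ico (0 : ℤ) q).filter (fun b : ℤ => b * r ≠ a * q),
        ‖trapK cc M L ((b : ℝ) / q - (a : ℝ) / r)‖ ≤
      2 * ((2 * (Int.gcd a r + 1) : ℕ) : ℝ) *
        (((2 * M + L : ℕ) : ℝ) * J + 2 * ((4 * (Q : ℝ) ^ 4 / L) / (Int.gcd a r : ℝ) ^ 2) / (J + 1)) := by
  classical
  have hL' : (0 : ℝ) < L := by exact_mod_cast hL
  have hr0 : 0 < r := by omega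
  have hr0' : (0 : ℝ) < r := by exact_mod_cast hr0
  have hrz : (r : ℤ) ≠ 0 := by exact_mod_cast hr0.ne'
  set d : ℕ := Int.gcd a r with hd
  have hd0 : 0 < d := Int.gcd_pos_of_ne_zero_right _ hrz
  have hda : (d : ℤ) ∣ a := Int.gcd_dvd_left a r
  have hdr : (d : ℤ) ∣ r := Int.gcd_dvd_right a r
  set A₀ : ℝ := ((2 * M + L : ℕ) : ℝ) with hA₀
  have hA0 : 0 ≤ A₀ := by positivity
  set C : ℝ := (4 * (L : ℝ))⁻¹ with hC
  have hC0 : 0 ≤ C := by positivity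
  set E : ℝ := 4 * (Q : ℝ) ^ 4 / L with hE
  have hE0 : 0 ≤ E := by positivity
  have hEC : E = C * (16 * (Q : ℝ) ^ 4) := by rw [hE, hC]; field_simp; ring
  set P := pairsB Q r a with hP
  -- the two integer numerators
  set α : ((_ : ℕ) × ℤ) → ℝ := fun x => (x.2 : ℝ) / x.1 - (a : ℝ) / r with hα
  set σ₁ : ((_ : ℕ) × ℤ) → ℤ := fun x => x.2 * r - a * x.1 - ⌊α x⌋ * (x.1 * r) with hσ₁
  set σ₂ : ((_ : ℕ) × ℤ) → ℤ := fun x => x.1 * r - σ₁ x with hσ₂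
  -- basic facts on `P`
  have hfacts : ∀ x ∈ P, (0 : ℝ) < x.1 ∧ (x.1 : ℝ) * r ≤ 4 * (Q : ℝ) ^ 2 ∧ -1 < α x ∧ α x < 1 ∧
      α x ≠ 0 ∧ (⌊α x⌋ = -1 ∨ ⌊α x⌋ = 0) := by
    intro x hx
    rw [hP, mem_pairsB] at hx
    obtain ⟨⟨hq1, hq2⟩, ⟨hb0, hbq⟩, hne⟩ := hx
    have hq0 : (0 : ℝ) < x.1 := by exact_mod_cast (show 0 < x.1 by omega)
    have hq2' : (x.1 : ℝ) ≤ 2 * Q := by exact_mod_cast hq2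
    have hr2' : (r : ℝ) ≤ 2 * Q := by exact_mod_cast hr2
    have hb0' : (0 : ℝ) ≤ x.2 := by exact_mod_cast hb0
    have hbq' : (x.2 : ℝ) < x.1 := by exact_mod_cast hbq
    have ha0' : (0 : ℝ) ≤ a := by exact_mod_cast ha0
    have har' : (a : ℝ) < r := by exact_mod_cast har
    have h1 : (x.2 : ℝ) / x.1 < 1 := by rw [div_lt_one hq0]; exact hbq'
    have h2 : 0 ≤ (x.2 : ℝ) / x.1 := by positivity
    have h3 : (a : ℝ) / r < 1 := by rw [div_lt_one hr0']; exact har'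
    have h4 : 0 ≤ (a : ℝ) / r := by positivity
    refine ⟨hq0, ?_, ?_, ?_, ?_, ?_⟩
    · nlinarith
    · simp only [hα]; linarith
    · simp only [hα]; linarith
    · intro h0
      apply hne
      have : (x.2 : ℝ) * r = a * x.1 := by
        simp only [hα] at h0
        field_simp at h0
        linarith
      exact_mod_cast this
    · by_cases hneg : α x < 0
      · left
        rw [Int.floor_eq_iff]
        simp only [hα] at hneg ⊢
        push_cast
        constructor <;> linarith
      · right
        rw [Int.floor_eq_iff]
        simp only [hα] at hneg ⊢
        push_cast
        constructor <;> linarith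
  have hfract : ∀ x ∈ P, Int.fract (α x) ≠ 0 := by
    intro x hx hf
    obtain ⟨-, -, hgt, hlt, hne, hfl⟩ := hfacts x hx
    have e : α x = ⌊α x⌋ := by
      have := Int.self_sub_floor (α x); rw [hf] at this; linarith
    rcases hfl with h | h
    · rw [h] at e; push_cast at e; linarith
    · rw [h] at e; push_cast at e; exact hne e
  have hσ₁R : ∀ x ∈ P, ((σ₁ x : ℤ) : ℝ) = Int.fract (α x) * ((x.1 : ℝ) * r) := by
    intro x hx
    obtain ⟨hq0, -⟩ := hfacts x hx
    rw [← Int.self_sub_floor]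
    simp only [hσ₁, hα]
    push_cast
    field_simp
  have hσ₂R : ∀ x ∈ P, ((σ₂ x : ℤ) : ℝ) = (1 - Int.fract (α x)) * ((x.1 : ℝ) * r) := by
    intro x hx
    simp only [hσ₂]
    push_cast
    rw [hσ₁R x hx]
    ring
  have hvpos : ∀ x ∈ P, 0 < Int.fract (α x) := fun x hx =>
    lt_of_le_of_ne (Int.fract_nonneg _) (Ne.symm (hfract x hx))
  have hv1 : ∀ x ∈ P, 0 < 1 - Int.fract (α x) := fun x _ => by
    linarith [Int.fract_lt_one (α x)]
  -- hypotheses of `sum_min_fibre_le` for `σ₁`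
  have hqr0 : ∀ x ∈ P, (0 : ℝ) < (x.1 : ℝ) * r := fun x hx => mul_pos (hfacts x hx).1 hr0'
  have h1pos : ∀ x ∈ P, 0 < σ₁ x := by
    intro x hx
    have : (0 : ℝ) < ((σ₁ x : ℤ) : ℝ) := by rw [hσ₁R x hx]; exact mul_pos (hvpos x hx) (hqr0 x hx)
    exact_mod_cast this
  have h2pos : ∀ x ∈ P, 0 < σ₂ x := by
    intro x hx
    have : (0 : ℝ) < ((σ₂ x : ℤ) : ℝ) := by rw [hσ₂R x hx]; exact mul_pos (hv1 x hx) (hqr0 x hx)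
    exact_mod_cast this
  have h1le : ∀ x ∈ P, σ₁ x ≤ (4 * Q ^ 2 : ℕ) := by
    intro x hx
    have hlt1 := Int.fract_lt_one (α x)
    have : ((σ₁ x : ℤ) : ℝ) ≤ ((4 * Q ^ 2 : ℕ) : ℝ) := by
      rw [hσ₁R x hx]; push_cast
      calc Int.fract (α x) * ((x.1 : ℝ) * r) ≤ 1 * ((x.1 : ℝ) * r) :=
            mul_le_mul_of_nonneg_right hlt1.le (hqr0 x hx).le
        _ ≤ 4 * (Q : ℝ) ^ 2 := by rw [one_mul]; exact (hfacts x hx).2.1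
    exact_mod_cast this
  have h2le : ∀ x ∈ P, σ₂ x ≤ (4 * Q ^ 2 : ℕ) := by
    intro x hx
    have hlt1 := (hvpos x hx).le
    have : ((σ₂ x : ℤ) : ℝ) ≤ ((4 * Q ^ 2 : ℕ) : ℝ) := by
      rw [hσ₂R x hx]; push_cast
      calc (1 - Int.fract (α x)) * ((x.1 : ℝ) * r) ≤ 1 * ((x.1 : ℝ) * r) :=
            mul_le_mul_of_nonneg_right (by linarith) (hqr0 x hx).le
        _ ≤ 4 * (Q : ℝ) ^ 2 := by rw [one_mul]; exact (hfacts x hx).2.1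
    exact_mod_cast this
  have h1dvd : ∀ x ∈ P, (d : ℤ) ∣ σ₁ x := by
    intro x _
    simp only [hσ₁]
    exact Dvd.dvd.sub (Dvd.dvd.sub (Dvd.dvd.mul_left hdr _) (Dvd.dvd.mul_right hda _))
      (Dvd.dvd.mul_left (Dvd.dvd.mul_left hdr _) _)
  have h2dvd : ∀ x ∈ P, (d : ℤ) ∣ σ₂ x := by
    intro x hx
    simp only [hσ₂]
    exact Dvd.dvd.sub (Dvd.dvd.mul_left hdr _) (h1dvd x hx)
  -- fibres
  have hfib1 : ∀ s : ℤ, #(P.filter (fun x => σ₁ x = s)) ≤ 2 * (d + 1) := by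
    intro s
    have hsub : P.filter (fun x => σ₁ x = s) ⊆
        P.filter (fun x => x.2 * r - a * x.1 - (-1) * (x.1 * r) = s) ∪
          P.filter (fun x => x.2 * r - a * x.1 - 0 * (x.1 * r) = s) := by
      intro x hx
      rw [mem_filter] at hx
      rw [mem_union, mem_filter, mem_filter]
      rcases (hfacts x hx.1).2.2.2.2.2 with h | h
      · left; refine ⟨hx.1, ?_⟩; have := hx.2; simp only [hσ₁, h] at this; linarith
      · right; refine ⟨hx.1, ?_⟩; have := hx.2; simp only [hσ₁, h] at this; linarith
    calc #(P.filter (fun x => σ₁ x = s)) ≤ _ := card_le_card hsub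
      _ ≤ _ := card_union_le _ _
      _ ≤ (d + 1) + (d + 1) := add_le_add (card_pairsB_fibre_le hQr (-1) s)
          (card_pairsB_fibre_le hQr 0 s)
      _ = 2 * (d + 1) := by ring
  have hfib2 : ∀ s : ℤ, #(P.filter (fun x => σ₂ x = s)) ≤ 2 * (d + 1) := by
    intro s
    have hsub : P.filter (fun x => σ₂ x = s) ⊆
        P.filter (fun x => x.2 * r - a * x.1 - 0 * (x.1 * r) = -s) ∪
          P.filter (fun x => x.2 * r - a * x.1 - 1 * (x.1 * r) = -s) := by
      intro x hx
      rw [mem_filter] at hx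
      rw [mem_union, mem_filter, mem_filter]
      rcases (hfacts x hx.1).2.2.2.2.2 with h | h
      · left; refine ⟨hx.1, ?_⟩; have := hx.2; simp only [hσ₂, hσ₁, h] at this; linarith
      · right; refine ⟨hx.1, ?_⟩; have := hx.2; simp only [hσ₂, hσ₁, h] at this; linarith
    calc #(P.filter (fun x => σ₂ x = s)) ≤ _ := card_le_card hsub
      _ ≤ _ := card_union_le _ _
      _ ≤ (d + 1) + (d + 1) := add_le_add (card_pairsB_fibre_le hQr 0 (-s))
          (card_pairsB_fibre_le hQr 1 (-s))
      _ = 2 * (d + 1) := by ring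
  -- pointwise bound
  have hpt : ∀ x ∈ P, ‖trapK cc M L (α x)‖ ≤
      min A₀ (E * (((σ₁ x : ℤ) : ℝ) ^ 2)⁻¹) + min A₀ (E * (((σ₂ x : ℤ) : ℝ) ^ 2)⁻¹) := by
    intro x hx
    have hb := le_min_add_min (norm_nonneg _) (norm_trapK_le_sum cc M L hL (α x))
      ((norm_trapK_le_fract cc M L hL (hfract x hx)).trans_eq (mul_add _ _ _))
      (by positivity) (by positivity)
    refine hb.trans (add_le_add ?_ ?_)
    · refine min_le_min le_rfl ?_
      rw [hEC, mul_assoc]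
      refine mul_le_mul_of_nonneg_left ?_ hC0
      -- `v⁻² ≤ 16Q⁴/σ₁²` with `σ₁ = v (q r)`, `(q r)² ≤ 16 Q⁴`
      have hv := hvpos x hx
      have hs : (0 : ℝ) < ((σ₁ x : ℤ) : ℝ) := by exact_mod_cast h1pos x hx
      rw [← div_eq_mul_inv, le_div_iff₀ (by positivity), hσ₁R x hx]
      calc (Int.fract (α x) ^ 2)⁻¹ * (Int.fract (α x) * ((x.1 : ℝ) * r)) ^ 2
          = ((x.1 : ℝ) * r) ^ 2 := by field_simp
        _ ≤ (4 * (Q : ℝ) ^ 2) ^ 2 := pow_le_pow_left₀ (hqr0 x hx).le (hfacts x hx).2.1 2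
        _ = 16 * (Q : ℝ) ^ 4 := by ring
    · refine min_le_min le_rfl ?_
      rw [hEC, mul_assoc]
      refine mul_le_mul_of_nonneg_left ?_ hC0
      have hv := hv1 x hx
      have hs : (0 : ℝ) < ((σ₂ x : ℤ) : ℝ) := by exact_mod_cast h2pos x hx
      rw [← div_eq_mul_inv, le_div_iff₀ (by positivity), hσ₂R x hx]
      calc ((1 - Int.fract (α x)) ^ 2)⁻¹ * ((1 - Int.fract (α x)) * ((x.1 : ℝ) * r)) ^ 2
          = ((x.1 : ℝ) * r) ^ 2 := by field_simp
        _ ≤ (4 * (Q : ℝ) ^ 2) ^ 2 := pow_le_pow_left₀ (hqr0 x hx).le (hfacts x hx).2.1 2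
        _ = 16 * (Q : ℝ) ^ 4 := by ring
  have hS1 := sum_min_fibre_le P σ₁ hd0 (4 * Q ^ 2) h1pos h1le h1dvd hfib1 hA0 hE0 J
  have hS2 := sum_min_fibre_le P σ₂ hd0 (4 * Q ^ 2) h2pos h2le h2dvd hfib2 hA0 hE0 J
  -- assemble
  rw [sum_sigma']
  change ∑ x ∈ P, ‖trapK cc M L (α x)‖ ≤ _
  calc ∑ x ∈ P, ‖trapK cc M L (α x)‖
      ≤ ∑ x ∈ P, (min A₀ (E * (((σ₁ x : ℤ) : ℝ) ^ 2)⁻¹) + min A₀ (E * (((σ₂ x : ℤ) : ℝ) ^ 2)⁻¹)) :=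
        sum_le_sum hpt
    _ = ∑ x ∈ P, min A₀ (E * (((σ₁ x : ℤ) : ℝ) ^ 2)⁻¹) +
          ∑ x ∈ P, min A₀ (E * (((σ₂ x : ℤ) : ℝ) ^ 2)⁻¹) := sum_add_distrib
    _ ≤ ((2 * (d + 1) : ℕ) : ℝ) * (A₀ * J + 2 * (E / (d : ℝ) ^ 2) / (J + 1)) +
          ((2 * (d + 1) : ℕ) : ℝ) * (A₀ * J + 2 * (E / (d : ℝ) ^ 2) / (J + 1)) :=
        add_le_add hS1 hS2
    _ = 2 * ((2 * (d + 1) : ℕ) : ℝ) * (A₀ * J + 2 * (E / (d : ℝ) ^ 2) / (J + 1)) := by ring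

/-- Lemma B with `L = N`, `2M + L ≤ 2N` and `J = ⌊Q²/(N d)⌋`: the double sum is at most `80 Q²`.
[folklore] -/
theorem sum_sum_norm_trapK_le' (cc : ℤ) (M L N : ℕ) (hN : 0 < N) (hLN : L = N)
    (hA : 2 * M + L ≤ 2 * N) (hQr : Q < r) (hr2 : r ≤ 2 * Q) (ha0 : 0 ≤ a) (har : a < r) :
    ∑ q ∈ Ioc Q (2 * Q), ∑ b ∈ (Ico (0 : ℤ) q).filter (fun b : ℤ => b * r ≠ a * q),
        ‖trapK cc M L ((b : ℝ) / q - (a : ℝ) / r)‖ ≤ 80 * (Q : ℝ) ^ 2 := by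
  have hL : 0 < L := by omega
  have hN' : (0 : ℝ) < N := by exact_mod_cast hN
  have hr0 : 0 < r := by omega
  set d : ℕ := Int.gcd a r with hd
  have hd0 : 0 < d := Int.gcd_pos_of_ne_zero_right _ (by exact_mod_cast hr0.ne')
  have hd' : (0 : ℝ) < d := by exact_mod_cast hd0
  set J : ℕ := Q ^ 2 / (N * d) with hJ
  have h := sum_sum_norm_trapK_le cc M L hL hQr hr2 ha0 har J
  refine h.trans ?_
  have hA' : ((2 * M + L : ℕ) : ℝ) ≤ 2 * N := by exact_mod_cast hA
  have hNd : 0 < N * d := Nat.mul_pos hN hd0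
  -- `J (N d) ≤ Q²` and `Q² < (J + 1)(N d)`
  have hJ1 : ((J * (N * d) : ℕ) : ℝ) ≤ ((Q ^ 2 : ℕ) : ℝ) := by
    exact_mod_cast Nat.div_mul_le_self _ _
  have hJ2 : ((Q ^ 2 : ℕ) : ℝ) < (((J + 1) * (N * d) : ℕ) : ℝ) := by
    have := Nat.lt_div_mul_add (a := Q ^ 2) hNd
    have e : (J + 1) * (N * d) = Q ^ 2 / (N * d) * (N * d) + N * d := by rw [hJ]; ring
    rw [e]; exact_mod_cast this
  push_cast at hJ1 hJ2
  have hm : ((2 * (d + 1) : ℕ) : ℝ) ≤ 4 * d := by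
    have : 2 * (d + 1) ≤ 4 * d := by omega
    exact_mod_cast this
  -- first term
  have t1 : 2 * ((2 * (d + 1) : ℕ) : ℝ) * (((2 * M + L : ℕ) : ℝ) * J) ≤ 16 * (Q : ℝ) ^ 2 := by
    calc 2 * ((2 * (d + 1) : ℕ) : ℝ) * (((2 * M + L : ℕ) : ℝ) * J)
        ≤ 2 * (4 * d) * ((2 * N) * J) := by gcongr
      _ = 16 * ((J : ℝ) * (N * d)) := by ring
      _ ≤ 16 * (Q : ℝ) ^ 2 := by linarith
  -- second term
  have t2 : 2 * ((2 * (d + 1) : ℕ) : ℝ) *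
      (2 * ((4 * (Q : ℝ) ^ 4 / L) / (d : ℝ) ^ 2) / (J + 1)) ≤ 64 * (Q : ℝ) ^ 2 := by
    rw [hLN]
    have hkey : (Q : ℝ) ^ 2 ≤ ((J : ℝ) + 1) * (N * d) := hJ2.le
    have hpos : (0 : ℝ) < ((J : ℝ) + 1) * (N * d) := by positivity
    calc 2 * ((2 * (d + 1) : ℕ) : ℝ) * (2 * ((4 * (Q : ℝ) ^ 4 / N) / (d : ℝ) ^ 2) / (J + 1))
        ≤ 2 * (4 * d) * (2 * ((4 * (Q : ℝ) ^ 4 / N) / (d : ℝ) ^ 2) / (J + 1)) := by gcongr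
      _ = 64 * ((Q : ℝ) ^ 2 * (Q : ℝ) ^ 2) / (((J : ℝ) + 1) * (N * d)) := by
          field_simp; ring
      _ ≤ 64 * ((Q : ℝ) ^ 2 * (((J : ℝ) + 1) * (N * d))) / (((J : ℝ) + 1) * (N * d)) := by
          gcongr
      _ = 64 * (Q : ℝ) ^ 2 := by field_simp
  calc 2 * ((2 * (d + 1) : ℕ) : ℝ) *
        (((2 * M + L : ℕ) : ℝ) * J + 2 * ((4 * (Q : ℝ) ^ 4 / L) / (d : ℝ) ^ 2) / (J + 1))
      = 2 * ((2 * (d + 1) : ℕ) : ℝ) * (((2 * M + L : ℕ) : ℝ) * J) +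
          2 * ((2 * (d + 1) : ℕ) : ℝ) * (2 * ((4 * (Q : ℝ) ^ 4 / L) / (d : ℝ) ^ 2) / (J + 1)) := by
        ring
    _ ≤ 16 * (Q : ℝ) ^ 2 + 64 * (Q : ℝ) ^ 2 := add_le_add t1 t2
    _ = 80 * (Q : ℝ) ^ 2 := by ring

end LemmaB

/-! ### Primitive vectors and the point set `{b/q : Q < q ≤ 2Q, b mod q, gcd(q, b) = 1}` -/

section Points

variable (k : ℕ)

/-- Primitivity of the integer vector `(q, b_1, …, b_k)`: `h.c.f.(q, b_1, …, b_k) = 1`, i.e. every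
common divisor of `q` and all the `b_l` is `1` (Heath-Brown: "`∑*` denotes summation for
`h.c.f.(q, b_1, b_2, b_3) = 1`"). [cite: HeathBrownActa2001, §13 (13.2)] -/
def IsPrimVec (q : ℕ) (b : Fin k → ℤ) : Prop :=
  ∀ d : ℕ, d ∣ q → (∀ l, (d : ℤ) ∣ b l) → d = 1

open scoped Classical in
/-- The point set of the `k`-dimensional large sieve at rational points with denominators in a dyadic
range: pairs `(q, b)` with `Q < q ≤ 2Q`, `b ∈ [0, q)^k` (a system of residues `b (mod q)`) and
`h.c.f.(q, b_1, …, b_k) = 1`; the attached point of `(ℝ/ℤ)^k` is `b/q`.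
[cite: HeathBrownActa2001, Lemma 13.1] -/
def fareyVecs (Q : ℕ) : Finset ((_ : ℕ) × (Fin k → ℤ)) :=
  (Ioc Q (2 * Q)).sigma fun q =>
    (Fintype.piFinset fun _ : Fin k => Ico (0 : ℤ) q).filter (fun b => IsPrimVec k q b)

/-- The lattice box `∏_l (lo_l, lo_l + N]` of side `N` (`N^k` lattice points). [folklore] -/
def latticeBox (lo : Fin k → ℤ) (N : ℕ) : Finset (Fin k → ℤ) :=
  Fintype.piFinset fun l => Ioc (lo l) (lo l + N)

variable {k}

/-- Membership in `fareyVecs`. [cite: HeathBrownActa2001, Lemma 13.1] -/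
theorem mem_fareyVecs {Q : ℕ} {x : (_ : ℕ) × (Fin k → ℤ)} :
    x ∈ fareyVecs k Q ↔
      (Q < x.1 ∧ x.1 ≤ 2 * Q) ∧ (∀ l, 0 ≤ x.2 l ∧ x.2 l < x.1) ∧ IsPrimVec k x.1 x.2 := by
  classical
  simp only [fareyVecs, mem_sigma, mem_Ioc, mem_filter, Fintype.mem_piFinset, mem_Ico]

/-- **Distinct primitive vectors give distinct points**: if `(q, b)` and `(r, a)` are primitive with
`q, r ≥ 1` and `b_l/q = a_l/r` for every `l`, then `q = r` and `b = a`. [folklore] -/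
theorem eq_of_isPrimVec_of_proportional {q r : ℕ} (hq : 0 < q) (hr : 0 < r) {b a : Fin k → ℤ}
    (hb : IsPrimVec k q b) (ha : IsPrimVec k r a) (h : ∀ l, b l * r = a l * q) :
    q = r ∧ b = a := by
  set g := Nat.gcd q r with hg
  have hg0 : 0 < g := Nat.gcd_pos_of_pos_left _ hq
  set q' := q / g with hq'
  set r' := r / g with hr'
  have eq1 : q' * g = q := Nat.div_mul_cancel (Nat.gcd_dvd_left q r)
  have er1 : r' * g = r := Nat.div_mul_cancel (Nat.gcd_dvd_right q r)
  have hcop : Nat.Coprime q' r' := Nat.coprime_div_gcd_div_gcd hg0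
  have hcopZ : IsCoprime (q' : ℤ) (r' : ℤ) := Nat.isCoprime_iff_coprime.mpr hcop
  have hgZ : (g : ℤ) ≠ 0 := by exact_mod_cast hg0.ne'
  -- `b_l r' = a_l q'`
  have h' : ∀ l, b l * r' = a l * q' := by
    intro l
    have := h l
    rw [← eq1, ← er1] at this
    push_cast at this
    have : (b l * r' - a l * q') * g = 0 := by linear_combination this
    rcases mul_eq_zero.mp this with h0 | h0
    · linarith
    · exact absurd h0 hgZ
  have hq'1 : q' = 1 := by
    refine hb q' ⟨g, eq1.symm⟩ fun l => ?_
    exact hcopZ.dvd_of_dvd_mul_right ⟨a l, by rw [h' l]; ring⟩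
  have hr'1 : r' = 1 := by
    refine ha r' ⟨g, er1.symm⟩ fun l => ?_
    exact hcopZ.symm.dvd_of_dvd_mul_right ⟨b l, by rw [← h' l]; ring⟩
  have hqr : q = r := by rw [← eq1, ← er1, hq'1, hr'1]
  refine ⟨hqr, funext fun l => ?_⟩
  have := h l
  rw [hqr] at this
  exact mul_right_cancel₀ (by exact_mod_cast hr.ne' : (r : ℤ) ≠ 0) this

/-- Two distinct elements of `fareyVecs` differ in some coordinate of the point: there is `i` with
`b_i/q ≠ a_i/r`. [folklore] -/
theorem exists_ne_of_mem_fareyVecs {Q : ℕ} {x y : (_ : ℕ) × (Fin k → ℤ)} (hx : x ∈ fareyVecs k Q)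
    (hy : y ∈ fareyVecs k Q) (hne : y ≠ x) : ∃ i, y.2 i * x.1 ≠ x.2 i * y.1 := by
  by_contra hall
  push Not at hall
  rw [mem_fareyVecs] at hx hy
  obtain ⟨h1, h2⟩ := eq_of_isPrimVec_of_proportional (by omega) (by omega) hy.2.2 hx.2.2 hall
  exact hne (Sigma.ext h1 (heq_of_eq h2))

end Points

/-! ### The multidimensional large sieve at the points `b/q` -/

/-- `e(∑_i f_i) = ∏_i e(f_i)`. [folklore] -/
theorem e_finset_sum {ι : Type*} (s : Finset ι) (f : ι → ℝ) :
    e (∑ i ∈ s, f i) = ∏ i ∈ s, e (f i) := by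
  classical
  induction s using Finset.induction_on with
  | empty => simp [e_zero]
  | insert a s ha ih => rw [sum_insert ha, prod_insert ha, e_add, ih]

section Main

variable {k : ℕ}

/-- **The row-sum bound.** With `c_l`, `M`, `L = N`, `2M + L ≤ 2N`, for every point `(r, a)` of
`fareyVecs k Q`:
`∑_{(q,b)} ∏_l |K_l(b_l/q − a_l/r)| ≤ (2M+L)^k + k · 80Q² · (6(N + 2Q))^{k−1}`: the diagonal term is
`∏ K_l(0) = (2M+L)^k`; any other point differs from `(r, a)` in some coordinate `i`
(`exists_ne_of_mem_fareyVecs`), the free coordinates contribute `≤ 6(N + q) ≤ 6(N + 2Q)` each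
(Lemma A) and the coordinate `i` together with the sum over `q` contributes `≤ 80Q²` (Lemma B).
[folklore] -/
theorem rowSum_le (c : Fin k → ℤ) (M L N : ℕ) (hN : 0 < N) (hLN : L = N) (hA : 2 * M + L ≤ 2 * N)
    {Q : ℕ} {x : (_ : ℕ) × (Fin k → ℤ)} (hx : x ∈ fareyVecs k Q) :
    ∑ y ∈ fareyVecs k Q,
        ‖∏ l, trapK (c l) M L ((y.2 l : ℝ) / y.1 - (x.2 l : ℝ) / x.1)‖ ≤
      ((2 * M + L : ℕ) : ℝ) ^ k + k * (80 * (Q : ℝ) ^ 2) * (6 * ((N : ℝ) + 2 * Q)) ^ (k - 1) := by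
  classical
  have hL0 : 0 < L := by omega
  set R := fareyVecs k Q with hR
  set A₀ : ℝ := ((2 * M + L : ℕ) : ℝ) with hA₀
  set W : ℝ := 6 * ((N : ℝ) + 2 * Q) with hW
  have hW0 : 0 ≤ W := by positivity
  obtain ⟨⟨hr1, hr2⟩, ha, hprim⟩ := mem_fareyVecs.mp hx
  have hr0 : 0 < x.1 := by omega
  -- the summand and its basic properties
  set g : ((_ : ℕ) × (Fin k → ℤ)) → ℝ := fun y =>
    ‖∏ l, trapK (c l) M L ((y.2 l : ℝ) / y.1 - (x.2 l : ℝ) / x.1)‖ with hg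
  have hg_eq : ∀ y, g y = ∏ l, ‖trapK (c l) M L ((y.2 l : ℝ) / y.1 - (x.2 l : ℝ) / x.1)‖ :=
    fun y => by simp only [hg, norm_prod]
  have hg0 : ∀ y, 0 ≤ g y := fun y => norm_nonneg _
  have hgx : g x = A₀ ^ k := by
    rw [hg_eq]
    simp only [sub_self, trapK_zero _ M L hL0, Complex.norm_natCast]
    rw [prod_const, card_univ, Fintype.card_fin]
  -- pointwise: `g y ≤ [y = x] A₀^k + ∑_i [b_i r ≠ a_i q] g y`
  have hpt : ∀ y ∈ R, g y ≤ (if y = x then A₀ ^ k else 0) +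
      ∑ i, (if y.2 i * x.1 ≠ x.2 i * y.1 then g y else 0) := by
    intro y hy
    have hnn : 0 ≤ ∑ i, (if y.2 i * x.1 ≠ x.2 i * y.1 then g y else 0) :=
      sum_nonneg fun i _ => by split_ifs <;> [exact hg0 _; exact le_rfl]
    by_cases hyx : y = x
    · rw [if_pos hyx]
      have : g y = A₀ ^ k := by rw [hyx, hgx]
      linarith
    · rw [if_neg hyx, zero_add]
      obtain ⟨i, hi⟩ := exists_ne_of_mem_fareyVecs hx hy hyx
      calc g y = (if y.2 i * x.1 ≠ x.2 i * y.1 then g y else 0) := by rw [if_pos hi]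
        _ ≤ ∑ i, (if y.2 i * x.1 ≠ x.2 i * y.1 then g y else 0) :=
            single_le_sum (f := fun i => if y.2 i * x.1 ≠ x.2 i * y.1 then g y else 0)
              (fun i _ => by split_ifs <;> [exact hg0 _; exact le_rfl]) (mem_univ i)
  -- the class-`i` sums
  have hclass : ∀ i : Fin k,
      ∑ y ∈ R, (if y.2 i * x.1 ≠ x.2 i * y.1 then g y else 0) ≤ 80 * (Q : ℝ) ^ 2 * W ^ (k - 1) := by
    intro i
    -- the superset `(Ioc Q 2Q).sigma (q ↦ ∏_l t q l)`
    set t : ℕ → Fin k → Finset ℤ := fun q l =>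
      if l = i then (Ico (0 : ℤ) q).filter (fun m : ℤ => m * x.1 ≠ x.2 i * q) else Ico (0 : ℤ) q
      with ht
    have hsub : R.filter (fun y => y.2 i * x.1 ≠ x.2 i * y.1) ⊆
        (Ioc Q (2 * Q)).sigma fun q => Fintype.piFinset (t q) := by
      intro y hy
      rw [mem_filter, hR, mem_fareyVecs] at hy
      obtain ⟨⟨⟨hq1, hq2⟩, hb, -⟩, hyi⟩ := hy
      rw [mem_sigma, mem_Ioc, Fintype.mem_piFinset]
      refine ⟨⟨hq1, hq2⟩, fun l => ?_⟩
      simp only [ht]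
      split_ifs with hl
      · subst hl
        rw [mem_filter, mem_Ico]
        exact ⟨hb l, hyi⟩
      · rw [mem_Ico]; exact hb l
    -- per `q`: factor the sum over the box `∏_l t q l`
    have hfac : ∀ q ∈ Ioc Q (2 * Q), ∑ b ∈ Fintype.piFinset (t q), g ⟨q, b⟩ ≤
        (∑ m ∈ (Ico (0 : ℤ) q).filter (fun m : ℤ => m * x.1 ≠ x.2 i * q),
          ‖trapK (c i) M L ((m : ℝ) / q - (x.2 i : ℝ) / x.1)‖) * W ^ (k - 1) := by
      intro q hq
      rw [mem_Ioc] at hq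
      have hq0 : 0 < q := by omega
      -- `∑_b ∏_l = ∏_l ∑_m`
      have e1 : ∑ b ∈ Fintype.piFinset (t q), g ⟨q, b⟩ =
          ∏ l, ∑ m ∈ t q l, ‖trapK (c l) M L ((m : ℝ) / q - (x.2 l : ℝ) / x.1)‖ := by
        rw [Finset.prod_univ_sum]
        exact sum_congr rfl fun b _ => hg_eq ⟨q, b⟩
      rw [e1, ← Finset.mul_prod_erase univ _ (mem_univ i)]
      have e2 : t q i = (Ico (0 : ℤ) q).filter (fun m : ℤ => m * x.1 ≠ x.2 i * q) := by
        simp only [ht, if_pos rfl]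
      rw [e2]
      refine mul_le_mul_of_nonneg_left ?_ (sum_nonneg fun m _ => norm_nonneg _)
      -- the free coordinates
      have e3 : ∀ l ∈ univ.erase i,
          ∑ m ∈ t q l, ‖trapK (c l) M L ((m : ℝ) / q - (x.2 l : ℝ) / x.1)‖ ≤ W := by
        intro l hl
        have hli : l ≠ i := ne_of_mem_erase hl
        simp only [ht, if_neg hli]
        calc ∑ m ∈ Ico (0 : ℤ) q, ‖trapK (c l) M L ((m : ℝ) / q - (x.2 l : ℝ) / x.1)‖
            ≤ 6 * ((N : ℝ) + q) := sum_norm_trapK_div_sub_le' (c l) M L N hN hLN hA hq0 _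
          _ ≤ W := by
              rw [hW]
              have : (q : ℝ) ≤ 2 * Q := by exact_mod_cast hq.2
              linarith
      calc ∏ l ∈ univ.erase i, ∑ m ∈ t q l, ‖trapK (c l) M L ((m : ℝ) / q - (x.2 l : ℝ) / x.1)‖
          ≤ ∏ l ∈ univ.erase i, W :=
            prod_le_prod (fun l _ => sum_nonneg fun m _ => norm_nonneg _) e3
        _ = W ^ (k - 1) := by
            rw [prod_const, card_erase_of_mem (mem_univ i), card_univ, Fintype.card_fin]
    -- Lemma B for the coordinate `i`
    have hB := sum_sum_norm_trapK_le' (c i) M L N hN hLN hA hr1 hr2 (ha i).1 (ha i).2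
    calc ∑ y ∈ R, (if y.2 i * x.1 ≠ x.2 i * y.1 then g y else 0)
        = ∑ y ∈ R.filter (fun y => y.2 i * x.1 ≠ x.2 i * y.1), g y := (sum_filter _ _).symm
      _ ≤ ∑ y ∈ (Ioc Q (2 * Q)).sigma (fun q => Fintype.piFinset (t q)), g y :=
          sum_le_sum_of_subset_of_nonneg hsub fun y _ _ => hg0 y
      _ = ∑ q ∈ Ioc Q (2 * Q), ∑ b ∈ Fintype.piFinset (t q), g ⟨q, b⟩ := sum_sigma _ _ _
      _ ≤ ∑ q ∈ Ioc Q (2 * Q), (∑ m ∈ (Ico (0 : ℤ) q).filter (fun m : ℤ => m * x.1 ≠ x.2 i * q),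
            ‖trapK (c i) M L ((m : ℝ) / q - (x.2 i : ℝ) / x.1)‖) * W ^ (k - 1) :=
          sum_le_sum hfac
      _ = (∑ q ∈ Ioc Q (2 * Q), ∑ m ∈ (Ico (0 : ℤ) q).filter (fun m : ℤ => m * x.1 ≠ x.2 i * q),
            ‖trapK (c i) M L ((m : ℝ) / q - (x.2 i : ℝ) / x.1)‖) * W ^ (k - 1) := by
          rw [sum_mul]
      _ ≤ 80 * (Q : ℝ) ^ 2 * W ^ (k - 1) :=
          mul_le_mul_of_nonneg_right hB (pow_nonneg hW0 _)
  -- assemble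
  calc ∑ y ∈ R, g y
      ≤ ∑ y ∈ R, ((if y = x then A₀ ^ k else 0) +
          ∑ i, (if y.2 i * x.1 ≠ x.2 i * y.1 then g y else 0)) := sum_le_sum hpt
    _ = ∑ y ∈ R, (if y = x then A₀ ^ k else 0) +
          ∑ i, ∑ y ∈ R, (if y.2 i * x.1 ≠ x.2 i * y.1 then g y else 0) := by
        rw [sum_add_distrib, sum_comm]
    _ ≤ A₀ ^ k + ∑ _i : Fin k, 80 * (Q : ℝ) ^ 2 * W ^ (k - 1) := by
        refine add_le_add ?_ (sum_le_sum fun i _ => hclass i)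
        rw [sum_ite_eq' R x, if_pos hx]
    _ = A₀ ^ k + k * (80 * (Q : ℝ) ^ 2) * W ^ (k - 1) := by
        rw [sum_const, card_univ, Fintype.card_fin, nsmul_eq_mul]; ring

/-- **The `k`-dimensional large sieve at the points `b/q`, `Q < q ≤ 2Q`, `h.c.f.(q, b) = 1`**
(Heath-Brown 2001, Lemma 13.1, in every dimension and with explicit constants): for complex weights
`G_β` on the lattice box `∏_l (lo_l, lo_l + N]` of side `N ≥ 1`,
`∑_{(q,b)} |∑_β G_β e(β·b/q)|² ≤ ((2N)^k + k · 80Q² · (6(N + 2Q))^{k−1}) ∑_β |G_β|²`.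
Bombieri's duality argument (Huxley 1972, ch. 7) with the product of trapezoid kernels
`K(α) = ∏_l K_l(α_l)` (`L = N`, plateau containing the box): by `duality` it suffices to bound the row
sums `∑_{(q,b)} ∏_l |K_l(b_l/q − a_l/r)|`, which is `rowSum_le`.  Heath-Brown proves the case `k = 3`
by iterating the Sobolev–Gallagher inequality and counting the points `(q, b)` in a box of side `S₀⁻¹`
((13.3)); the row-sum count here plays the role of (13.3).
[cite: HeathBrownActa2001, Lemma 13.1] [cite: Huxley1972, Ch. 7, (7.11)–(7.25)] -/
theorem largeSieve_multidim (lo : Fin k → ℤ) {N : ℕ} (hN : 0 < N) (G : (Fin k → ℤ) → ℂ) (Q : ℕ) :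
    ∑ x ∈ fareyVecs k Q,
        ‖∑ β ∈ latticeBox k lo N, G β * e (∑ l, (β l : ℝ) * ((x.2 l : ℝ) / x.1))‖ ^ 2 ≤
      ((2 * (N : ℝ)) ^ k + k * (80 * (Q : ℝ) ^ 2) * (6 * ((N : ℝ) + 2 * Q)) ^ (k - 1)) *
        ∑ β ∈ latticeBox k lo N, ‖G β‖ ^ 2 := by
  classical
  -- kernel parameters: `M = ⌊N/2⌋`, `L = N`, `c_l = lo_l + N - M`
  obtain ⟨M, hM⟩ : ∃ M : ℕ, M = N / 2 := ⟨_, rfl⟩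
  obtain ⟨c, hc⟩ : ∃ c : Fin k → ℤ, ∀ l, c l = lo l + N - M := ⟨_, fun l => rfl⟩
  have h2M : 2 * M ≤ N := hM ▸ Nat.mul_div_le N 2
  have h2M' : N ≤ 2 * M + 1 := by omega
  have hA : 2 * M + N ≤ 2 * N := by omega
  set S : Finset (Fin k → ℤ) := latticeBox k lo N with hS
  set T : Finset (Fin k → ℤ) := Fintype.piFinset fun l => window (c l) M N with hT
  have hplateau : ∀ β ∈ S, ∀ l, |β l - c l| ≤ (M : ℤ) := by
    intro β hβ l
    rw [hS, latticeBox, Fintype.mem_piFinset] at hβ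
    have h := hβ l
    rw [mem_Ioc] at h
    rw [hc l, abs_le]
    constructor <;> omega
  have hST : S ⊆ T := by
    intro β hβ
    rw [hT, Fintype.mem_piFinset]
    intro l
    have h := hplateau β hβ l
    rw [abs_le] at h
    rw [window, mem_Icc]
    push_cast
    omega
  set R := fareyVecs k Q with hR
  -- the vectors fed to the duality lemma
  set u : (Fin k → ℤ) → ℂ := fun β => if β ∈ S then G β else 0 with hu
  set wt : (Fin k → ℤ) → ℝ := fun β => ∏ l, trapW (c l) M N (β l) with hwt
  have hwt0 : ∀ β, 0 ≤ wt β := fun β => prod_nonneg fun l _ => trapW_nonneg _ _ _ _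
  have hwt1 : ∀ β ∈ S, wt β = 1 := fun β hβ =>
    prod_eq_one fun l _ => trapW_eq_one (c l) M N hN (hplateau β hβ l)
  set f : ((_ : ℕ) × (Fin k → ℤ)) → (Fin k → ℤ) → ℂ := fun x β =>
    (Real.sqrt (wt β) : ℂ) * e (-(∑ l, (β l : ℝ) * ((x.2 l : ℝ) / x.1))) with hf
  have h_inner : ∀ x : (_ : ℕ) × (Fin k → ℤ), ∑ β ∈ T, u β * conj (f x β) =
      ∑ β ∈ S, G β * e (∑ l, (β l : ℝ) * ((x.2 l : ℝ) / x.1)) := by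
    intro x
    have h : ∀ β ∈ T, u β * conj (f x β) =
        if β ∈ S then G β * e (∑ l, (β l : ℝ) * ((x.2 l : ℝ) / x.1)) else 0 := by
      intro β _
      simp only [hu, hf]
      split_ifs with hβ
      · rw [map_mul, Complex.conj_ofReal, conj_e, neg_neg, hwt1 β hβ, Real.sqrt_one]
        push_cast; ring
      · rw [zero_mul]
    rw [sum_congr rfl h, sum_ite_mem, inter_eq_right.2 hST]
  have h_norm : ∑ β ∈ T, ‖u β‖ ^ 2 = ∑ β ∈ S, ‖G β‖ ^ 2 := by
    have h : ∀ β ∈ T, ‖u β‖ ^ 2 = if β ∈ S then ‖G β‖ ^ 2 else 0 := by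
      intro β _; simp only [hu]; split_ifs <;> simp
    rw [sum_congr rfl h, sum_ite_mem, inter_eq_right.2 hST]
  have h_gram : ∀ x y : (_ : ℕ) × (Fin k → ℤ), ∑ β ∈ T, f x β * conj (f y β) =
      ∏ l, trapK (c l) M N ((y.2 l : ℝ) / y.1 - (x.2 l : ℝ) / x.1) := by
    intro x y
    have h1 : ∀ β, f x β * conj (f y β) =
        ∏ l, ((trapW (c l) M N (β l) : ℂ) *
          e ((β l : ℝ) * ((y.2 l : ℝ) / y.1 - (x.2 l : ℝ) / x.1))) := by
      intro β
      simp only [hf, map_mul, Complex.conj_ofReal, conj_e, neg_neg]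
      have hw := hwt0 β
      calc (Real.sqrt (wt β) : ℂ) * e (-∑ l, (β l : ℝ) * ((x.2 l : ℝ) / x.1)) *
            ((Real.sqrt (wt β) : ℂ) * e (∑ l, (β l : ℝ) * ((y.2 l : ℝ) / y.1)))
          = ((Real.sqrt (wt β) * Real.sqrt (wt β) : ℝ) : ℂ) *
              (e (-∑ l, (β l : ℝ) * ((x.2 l : ℝ) / x.1)) *
                e (∑ l, (β l : ℝ) * ((y.2 l : ℝ) / y.1))) := by
            push_cast; ring
        _ = (wt β : ℂ) * e (∑ l, (β l : ℝ) * ((y.2 l : ℝ) / y.1 - (x.2 l : ℝ) / x.1)) := by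
            rw [Real.mul_self_sqrt hw, ← e_add]
            congr 2
            simp only [mul_sub, Finset.sum_sub_distrib]
            ring
        _ = ∏ l, ((trapW (c l) M N (β l) : ℂ) *
              e ((β l : ℝ) * ((y.2 l : ℝ) / y.1 - (x.2 l : ℝ) / x.1))) := by
            rw [prod_mul_distrib, ← e_finset_sum]
            simp only [hwt, Complex.ofReal_prod]
    simp only [h1]
    have e2 := Finset.prod_univ_sum (fun l => window (c l) M N)
      (fun l (m : ℤ) => (trapW (c l) M N m : ℂ) *
        e ((m : ℝ) * ((y.2 l : ℝ) / y.1 - (x.2 l : ℝ) / x.1)))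
    rw [hT, ← e2]
    rfl
  -- the row-sum bound and duality
  set B : ℝ := ((2 * M + N : ℕ) : ℝ) ^ k +
    k * (80 * (Q : ℝ) ^ 2) * (6 * ((N : ℝ) + 2 * Q)) ^ (k - 1) with hB
  have hB0 : 0 ≤ B := by positivity
  have hBrow : ∀ x ∈ R, ∑ y ∈ R, ‖∑ β ∈ T, f x β * conj (f y β)‖ ≤ B := by
    intro x hx
    simp only [h_gram]
    exact rowSum_le c M N N hN rfl hA hx
  have hmain := duality R T u f hB0 hBrow
  simp only [h_inner, h_norm] at hmain
  refine hmain.trans ?_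
  rw [mul_comm]
  refine mul_le_mul_of_nonneg_right ?_ (sum_nonneg fun n _ => by positivity)
  have hA' : ((2 * M + N : ℕ) : ℝ) ≤ 2 * N := by exact_mod_cast hA
  rw [hB]
  gcongr

/-- **Heath-Brown's Lemma 13.1 (the three-dimensional large sieve)**: "Let
`S(a) = S(a, C) = ∑_{β̂ ∈ C} exp{2πi a·β̂} G_β` ((13.1)), with `C` a cube of side `S₀`. Then
`∑_{Q < q ≤ 2Q} ∑*_{b (mod q)} |S(q⁻¹b)|² ≪ (S₀³ + Q²S₀² + Q⁴) ∑_{β̂ ∈ C} |G_β|²`", where `∑*` denotes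
summation for `h.c.f.(q, b_1, b_2, b_3) = 1` (p. 79; Harman, *Prime-Detecting Sieves*, Lemma 13.23).
Here for the lattice cube `∏_{l<3} (lo_l, lo_l + N]` of side `N ≥ 1` (the lattice points of any cube
of side `S₀` in `ℝ³` lie in such a box with `N = ⌊S₀⌋ + 1`, extending `G` by zero) and with the explicit
constant `51840`, from `largeSieve_multidim`: `(2N)³ + 240Q²(6(N + 2Q))² ≤ 51840(N³ + Q²N² + Q⁴)`.
[cite: HeathBrownActa2001, Lemma 13.1] [cite: Harman2007, Lemma 13.23] -/
theorem largeSieve_dim_three (lo : Fin 3 → ℤ) {N : ℕ} (hN : 0 < N) (G : (Fin 3 → ℤ) → ℂ) (Q : ℕ) :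
    ∑ x ∈ fareyVecs 3 Q,
        ‖∑ β ∈ latticeBox 3 lo N, G β * e (∑ l, (β l : ℝ) * ((x.2 l : ℝ) / x.1))‖ ^ 2 ≤
      51840 * ((N : ℝ) ^ 3 + (Q : ℝ) ^ 2 * (N : ℝ) ^ 2 + (Q : ℝ) ^ 4) *
        ∑ β ∈ latticeBox 3 lo N, ‖G β‖ ^ 2 := by
  refine (largeSieve_multidim lo hN G Q).trans
    (mul_le_mul_of_nonneg_right ?_ (sum_nonneg fun _ _ => by positivity))
  have hN0 : (0 : ℝ) ≤ N := by positivity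
  have hQ0 : (0 : ℝ) ≤ Q := by positivity
  norm_num
  nlinarith [pow_nonneg hN0 3, mul_nonneg (sq_nonneg (Q : ℝ)) (sq_nonneg ((Q : ℝ) - N)),
    mul_nonneg (sq_nonneg (Q : ℝ)) (sq_nonneg (N : ℝ))]

end Main

end Literature.NumberTheory.Sieve.LargeSieve

end
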